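/-
Skeleton line `lrad-gluing` for crux item stmt-PneNP-18538 (`StrongComposition`, C1), registered on the
RUNG `StrongCompositionLRAD` (C1 restricted to the disciplined class LRAD) — planner-pnp-ideate-p4, gen 19.
FRONTIER work; nothing here bears on `P ≠ NP`.
-/
import Mathlib
import Summits.PneNP.PneNP.Theses.KrwChromaticSteering
import Literature.Computability.Complexity.KRWComposition
import Literature.Computability.Complexity.KWDepthHardFunctions

/-!
# Line `lrad-gluing`: the rung C1|LRAD as a ONE-STUB skeleton

Target (registered with `--crux-decl`): `StrongCompositionLRAD` — C1 (`Theses.KrwChromaticSteering.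
StrongComposition`) verbatim, restricted to protocols that are `LRADisciplined` (node tests = label tests ∨
affine tests ∨ single-row tests, rows typed online `algebraic` / `combinatorial`, no row both).  It is
implied by C1 (`lrad_of_strongComposition`) and contains both classes on which C1 is proved (M3 = label ∨
public-row tests, p5 g17; L⁺ = label ∨ affine tests, p4 g18) — see `Cruxes/StrongComposition/
LensBarrierP4g19.lean` §3 for the inclusions and `LensBarrierP4g19.md` §5 for the gluing recipe.

Stub (the only one): `stub_lradQuantitative : LRADQuantitative` — the glued adversary bound
`ℓ + min(dg, q − 1) ≤ P.depth + 2` (label hardness `ℓ`, KW-depth `dg` of `g`, per-row affine budget `q`)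
on disciplined protocols; its step table is memo §5.3; size L (≈ 1 200–1 600 lines, a fibred re-run of
M3's invariant induction).  Why ONE stub is honest and not a shred: every other piece of the line is PROVED
below — S0 `jointHardGeneric_exists` (one `g` both KW-depth-hard and affine-generic, joint counting), S1
`sat_setRow_of_touching` (row surgery), S2 `exists_X_fibred` (fibred realisability), S3
`perRowLUOfGeneric_holds` (per-row label-universality) and the assembly
`strongCompositionLRAD_of_quantitative`; the composition `StrongCompositionLRAD_of` is that assembly.
The stub is NOT a restatement of the target: it fixes the hypotheses on `g` (any `g` with the two
hardness properties, not an existential), is quantitative with explicit constants, and the target follows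
from it only through S0, S3 and the tree's `liftRows` embedding.

This file is `LensBarrierP4g19.lean` (commit c8d411a66445) minus its §1/§2/§4 material (same-side splits,
private collapse, the LAM classes), under its own namespace so that both files can coexist in a build;
declarations are byte-identical to their `P4g19` namesakes.
-/

set_option linter.dupNamespace false
set_option autoImplicit false

namespace Summit.PneNP.PneNP.Cruxes.StrongComposition.LradGluing

open Literature.Computability.Complexity

universe u
/-! ## §0  Rectangle vocabulary of p5 g17 (`LensNegationP5g17.lean` §1), restated VERBATIM
(crux workfiles downstream of the disprover's `Disproof.lean` are not importable between world builds;
the three declarations read identically against `LabelPublic.SolvesRect`, `LabelPublic.Hard`,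
`LabelPublic.Hard.of_le`). -/

section Rect

variable {ι : Type u}

/-- [verbatim `LabelPublic.SolvesRect`] the tree `Q` solves the KW game on the rectangle `A × B`. -/
def SolvesRect (Q : KWTree ι) (A B : Set (ι → Bool)) : Prop :=
  ∀ a ∈ A, ∀ b ∈ B, a (Q.run a b) ≠ b (Q.run a b)

/-- [verbatim `LabelPublic.Hard`] every tree solving `A × B` has depth `≥ ℓ`. -/
def Hard (A B : Set (ι → Bool)) (ℓ : ℕ) : Prop :=
  ∀ Q : KWTree ι, SolvesRect Q A B → ℓ ≤ Q.depth

theorem Hard.of_le {A B : Set (ι → Bool)} {ℓ ℓ' : ℕ} (h : Hard A B ℓ) (hℓ : ℓ' ≤ ℓ) : Hard A B ℓ' :=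
  fun Q hQ => hℓ.trans (h Q hQ)

end Rect

/-! ## §3  The disciplined class LRAD, typed (trimmed from `LensBarrierP4g19.lean` §3) -/

section Discipline

variable {m n : ℕ}

/-! ### Vocabulary of g18 (`LensBarrierP4g18.lean` §1, §4), restated VERBATIM.
Crux workfiles committed after the farm's last world build are not importable (`lean check` answers
`stale:unbuilt`), so — as for the g13/g14 vocabulary before — the eight declarations this section
relates to are restated word for word; every statement below reads identically against the originals
`P4g18.parityOn … P4g18.StrongCompositionLRA`. -/

/-- [verbatim `P4g18.parityOn`] Parity of the entries of `X` on the support `S ⊆ [m] × [n]`. -/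
def parityOn (S : Finset (Fin m × Fin n)) (X : Fin m × Fin n → Bool) : Bool :=
  Nat.bodd (S.filter fun p => X p = true).card

/-- [verbatim `P4g18.IsAffineTest`] `X ↦ c ⊕ ⨁_{p ∈ S} X p`. -/
def IsAffineTest (s : (Fin m × Fin n → Bool) → Bool) : Prop :=
  ∃ (S : Finset (Fin m × Fin n)) (c : Bool), ∀ X, s X = Bool.xor c (parityOn S X)

/-- [verbatim `P4g18.IsLabelTest`] a function of the own label vector only. -/
def IsLabelTest (g : (Fin n → Bool) → Bool) (s : (Fin m × Fin n → Bool) → Bool) : Prop :=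
  ∃ φ : (Fin m → Bool) → Bool, ∀ X, s X = φ (rowLabels g X)

/-- [verbatim `P4g18.IsRowTest`] a function of one own row `X_i`, `i` fixed at the node. -/
def IsRowTest (s : (Fin m × Fin n → Bool) → Bool) : Prop :=
  ∃ (i : Fin m) (ψ : (Fin n → Bool) → Bool), ∀ X, s X = ψ (row X i)



/-- The row type a path assigns online: untouched, algebraic (met by an affine test), combinatorial
(met by a single-row test). -/
inductive RowType
  | fresh
  | algebraic
  | combinatorial
  deriving DecidableEq

/-- The rows an affine support `S` touches. -/
def touchedRows (S : Finset (Fin m × Fin n)) : Finset (Fin m) := S.image Prod.fst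

/-- Retyping below an affine node: touched rows become `algebraic`. -/
def retag (S : Finset (Fin m × Fin n)) (τ : Fin m → RowType) : Fin m → RowType :=
  fun i => if i ∈ touchedRows S then RowType.algebraic else τ i

theorem retag_ne_combinatorial (S : Finset (Fin m × Fin n)) {τ : Fin m → RowType}
    (hτ : ∀ i, τ i ≠ .combinatorial) (i : Fin m) : retag S τ i ≠ .combinatorial := by
  unfold retag
  split
  · exact fun h => RowType.noConfusion h
  · exact hτ i

theorem update_ne_algebraic {τ : Fin m → RowType} (hτ : ∀ i, τ i ≠ .algebraic) (i i' : Fin m) :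
    Function.update τ i RowType.combinatorial i' ≠ .algebraic := by
  rcases eq_or_ne i' i with rfl | hne
  · rw [Function.update_self]
    exact fun h => RowType.noConfusion h
  · rw [Function.update_of_ne hne]
    exact hτ i'

/-- One node of **the disciplined class LRAD** (relative to an online typing `τ`): the test is a label
test (typing unchanged), OR an affine test whose support avoids `combinatorial` rows (touched rows become
`algebraic` below it), OR a single-row test on a row that is not `algebraic` (it becomes `combinatorial`
below it).  `NodeOK g τ s τ'` says: test `s` is legal at typing `τ` and `τ'` is the typing below it. -/
def NodeOK (g : (Fin n → Bool) → Bool) (τ : Fin m → RowType) (s : (Fin m × Fin n → Bool) → Bool)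
    (τ' : Fin m → RowType) : Prop :=
  (IsLabelTest g s ∧ τ' = τ) ∨
  (∃ (S : Finset (Fin m × Fin n)) (c : Bool), (∀ X, s X = Bool.xor c (parityOn S X)) ∧
      (∀ i ∈ touchedRows S, τ i ≠ .combinatorial) ∧ τ' = retag S τ) ∨
  (∃ (i : Fin m) (ψ : (Fin n → Bool) → Bool), (∀ X, s X = ψ (row X i)) ∧ τ i ≠ .algebraic ∧
      τ' = Function.update τ i .combinatorial)

/-- **Class LRAD**: along every root–leaf path no row carries both a single-row test and an affine test
(rows are typed online at first touch). -/
def LRADisciplinedOn (g : (Fin n → Bool) → Bool) : (Fin m → RowType) → KWTree (Fin m × Fin n) → Prop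
  | _, .leaf _ => True
  | τ, .alice s P Q => ∃ τ', NodeOK g τ s τ' ∧ LRADisciplinedOn g τ' P ∧ LRADisciplinedOn g τ' Q
  | τ, .bob s P Q => ∃ τ', NodeOK g τ s τ' ∧ LRADisciplinedOn g τ' P ∧ LRADisciplinedOn g τ' Q

/-- Disciplined from the all-`fresh` typing. -/
def LRADisciplined (g : (Fin n → Bool) → Bool) (P : KWTree (Fin m × Fin n)) : Prop :=
  LRADisciplinedOn g (fun _ => RowType.fresh) P

/-- **C1 restricted to the disciplined class** — the rung between {M3, L⁺} and K2 (`g` existential,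
loss `O(log mn)`, verbatim C1 otherwise). -/
def StrongCompositionLRAD : Prop :=
  ∃ c : ℕ, ∀ m n : ℕ, 1 ≤ n → ∀ f : (Fin m → Bool) → Bool, (∃ a b, f a ≠ f b) →
    ∃ g : (Fin n → Bool) → Bool, ∀ P : KWTree (Fin m × Fin n), LRADisciplined g P → P.SolvesStrong f g →
      ∃ Q : KWTree (Fin m), Q.Solves f ∧ Q.depth + n ≤ P.depth + c * (Nat.log 2 (m * n) + 1)

/-- C1 implies its LRAD restriction (a refutation of the rung refutes C1; a proof is a rung). -/
theorem lrad_of_strongComposition :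
    Theses.KrwChromaticSteering.StrongComposition → StrongCompositionLRAD := by
  rintro ⟨c, h⟩
  refine ⟨c, fun m n hn f hf => ?_⟩
  obtain ⟨g, hg⟩ := h m n hn f hf
  exact ⟨g, fun P _ hP => hg P hP⟩


end Discipline


/-! ## §5 PerRowBudget — label-universality with a budget PER ROW (support statement S3, typed)

L⁺ (`P4g18.depth_lower_bound`) spends ONE global budget `q − 1` of parity equations for the whole
`m × n` matrix (`MatrixLU g m q`: at most `q` equations in total).  The merged adversaries of the memo
(§2, §5) charge an affine equation to the rows it touches and use a MIN over rows, which needs the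
sharper universality below: a satisfiable system in which every ROW is touched by at most `q` equations
has a solution with every prescribed label vector.  Why true (memo §5.3, S3): let `V_i` be the span of
the equations of `span(E)` supported on rows `≤ i`; `dim V_i − dim V_{i−1} ≤ #{e ∈ E touching row i}`
because `V_i / V_{i−1}` injects into the span of the row-`i` parts of the equations touching row `i`;
choose the rows in order `1, …, m`, row `i` subject to `dim V_i − dim V_{i−1} ≤ q ≤ n − r − 1`
independent affine conditions, inside which an `r`-generic `g` takes the wanted label. -/

section PerRowBudget

variable {m n : ℕ}

/-- [verbatim `P4g18.AffSys`] A system of parity equations on `m × n` matrices. -/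
abbrev AffSys (m n : ℕ) := List (Finset (Fin m × Fin n) × Bool)

/-- [verbatim `P4g18.Sat`] `X` satisfies every equation of `E`. -/
def Sat (E : AffSys m n) (X : Fin m × Fin n → Bool) : Prop := ∀ e ∈ E, parityOn e.1 X = e.2

/-- [verbatim `P4g18.MatrixLU`] Label-universality up to `q` equations IN TOTAL. -/
def MatrixLU (g : (Fin n → Bool) → Bool) (m q : ℕ) : Prop :=
  ∀ E : AffSys m n, E.length ≤ q → (∃ X, Sat E X) → ∀ v : Fin m → Bool, ∃ X, Sat E X ∧ rowLabels g X = v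

/-- [verbatim `P4g18.rowParity`] Parity of `x` on a support `S ⊆ [n]` (one row). -/
def rowParity (S : Finset (Fin n)) (x : Fin n → Bool) : Bool := Nat.bodd (S.filter fun j => x j = true).card

/-- [verbatim `P4g18.AffGeneric`] `r`-affine-genericity of `g` by equations. -/
def AffGeneric (g : (Fin n → Bool) → Bool) (r : ℕ) : Prop :=
  ∀ E : List (Finset (Fin n) × Bool), E.length + r + 1 ≤ n →
    (∃ x, ∀ e ∈ E, rowParity e.1 x = e.2) → ∀ β : Bool, ∃ x, (∀ e ∈ E, rowParity e.1 x = e.2) ∧ g x = β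

/-- The rows an equation support touches. -/
def eqRows (S : Finset (Fin m × Fin n)) : Finset (Fin m) := S.image Prod.fst

/-- ROW LOAD: the number of equations of `E` whose support meets row `i`. -/
def rowLoad (E : AffSys m n) (i : Fin m) : ℕ := (E.filter fun e => i ∈ eqRows e.1).length

theorem rowLoad_le_length (E : AffSys m n) (i : Fin m) : rowLoad E i ≤ E.length :=
  List.length_filter_le _ _

/-- **Label-universality with a per-row budget** `q`: every satisfiable system touching each row at most
`q` times has, for every label vector, a solution carrying those labels. -/
def PerRowLU (g : (Fin n → Bool) → Bool) (m q : ℕ) : Prop :=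
  ∀ E : AffSys m n, (∀ i, rowLoad E i ≤ q) → (∃ X, Sat E X) →
    ∀ v : Fin m → Bool, ∃ X, Sat E X ∧ rowLabels g X = v

/-- The per-row budget refines the global one. -/
theorem matrixLU_of_perRowLU {g : (Fin n → Bool) → Bool} {q : ℕ} (h : PerRowLU g m q) :
    MatrixLU g m q := fun E hE hsat v =>
  h E (fun i => (rowLoad_le_length E i).trans hE) hsat v

/-- **S3 (support statement, unproved here)**: an `r`-generic non-constant `g` is label-universal with
PER-ROW budget `n − r − 1`, for every number of rows.  Proof route in the section docstring (filtration
`V_i`, `dim V_i − dim V_{i−1} ≤ rowLoad E i`, rows chosen in order).  It strictly strengthens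
`P4g18.MatrixLUOfGeneric` (`matrixLU_of_perRowLU`). -/
def PerRowLUOfGeneric : Prop :=
  ∀ (m n r : ℕ) (g : (Fin n → Bool) → Bool), (∃ u v, g u = true ∧ g v = false) →
    AffGeneric g r → PerRowLU g m (n - r - 1)

/-! ### S3 PROVED: `perRowLUOfGeneric_holds` (row surgery, ported from g18's `matrixLUOfGeneric_holds`
with the one change that genericity is applied to the equations TOUCHING the row being re-chosen —
`rowLoad E i` of them — the others being invariant under `setRow`) -/

/-- [verbatim `P4g18.setRow`] Replace row `i` of `X` by `y`. -/
def setRow (X : Fin m × Fin n → Bool) (i : Fin m) (y : Fin n → Bool) : Fin m × Fin n → Bool :=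
  fun p => if p.1 = i then y p.2 else X p

@[simp] theorem row_setRow_same (X : Fin m × Fin n → Bool) (i : Fin m) (y : Fin n → Bool) :
    row (setRow X i y) i = y := by
  funext j; simp [row, setRow]

theorem row_setRow_of_ne (X : Fin m × Fin n → Bool) {i i' : Fin m} (y : Fin n → Bool) (h : i' ≠ i) :
    row (setRow X i y) i' = row X i' := by
  funext j; simp [row, setRow, h]

/-- [verbatim `P4g18.rowSupp`] The row-`i` part of a support, as a subset of `[n]`. -/
def rowSupp (S : Finset (Fin m × Fin n)) (i : Fin m) : Finset (Fin n) :=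
  (S.filter fun p => p.1 = i).image Prod.snd

/-- [verbatim `P4g18.offRow`] The off-row-`i` part of a support. -/
def offRow (S : Finset (Fin m × Fin n)) (i : Fin m) : Finset (Fin m × Fin n) :=
  S.filter fun p => p.1 ≠ i

/-- [verbatim `P4g18.parityOn_setRow`] -/
theorem parityOn_setRow (S : Finset (Fin m × Fin n)) (X : Fin m × Fin n → Bool) (i : Fin m)
    (y : Fin n → Bool) :
    parityOn S (setRow X i y) = Bool.xor (rowParity (rowSupp S i) y) (parityOn (offRow S i) X) := by
  unfold parityOn rowParity
  have hsplit : S.filter (fun p => setRow X i y p = true)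
      = (S.filter fun p => p.1 = i).filter (fun p => y p.2 = true)
        ∪ (offRow S i).filter (fun p => X p = true) := by
    ext p
    rcases p with ⟨i', j⟩
    simp only [Finset.mem_filter, Finset.mem_union, offRow]
    by_cases h : i' = i
    · subst h; simp [setRow]
    · simp [setRow, h]
  have hdisj : Disjoint ((S.filter fun p => p.1 = i).filter (fun p => y p.2 = true))
      ((offRow S i).filter (fun p => X p = true)) := by
    rw [Finset.disjoint_left]
    intro p hp hq
    simp only [Finset.mem_filter, offRow] at hp hq
    exact hq.1.2 hp.1.2
  have hcard : ((S.filter fun p => p.1 = i).filter (fun p => y p.2 = true)).card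
      = ((rowSupp S i).filter fun j => y j = true).card := by
    unfold rowSupp
    rw [Finset.filter_image, Finset.card_image_of_injOn]
    rintro ⟨i₁, j₁⟩ hp ⟨i₂, j₂⟩ hq h
    simp only [Finset.coe_filter, Set.mem_setOf_eq, Finset.mem_filter] at hp hq
    simp only at h
    subst h
    rcases hp with ⟨⟨_, rfl⟩, _⟩
    rcases hq with ⟨⟨_, rfl⟩, _⟩
    rfl
  rw [hsplit, Finset.card_union_of_disjoint hdisj, Nat.bodd_add, hcard]

/-- [verbatim `P4g18.restrictRow`] The system `E` restricted to row `i`, the other rows frozen at `X`. -/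
def restrictRow (E : AffSys m n) (i : Fin m) (X : Fin m × Fin n → Bool) :
    List (Finset (Fin n) × Bool) :=
  E.map fun e => (rowSupp e.1 i, Bool.xor e.2 (parityOn (offRow e.1 i) X))

/-- An equation not touching row `i` has empty row-`i` support … -/
theorem rowSupp_eq_empty {S : Finset (Fin m × Fin n)} {i : Fin m} (h : i ∉ eqRows S) :
    rowSupp S i = ∅ := by
  unfold rowSupp
  rw [Finset.image_eq_empty, Finset.filter_eq_empty_iff]
  intro p hp hpi
  exact h (Finset.mem_image.2 ⟨p, hp, hpi⟩)

/-- … and is its own off-row part. -/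
theorem offRow_eq_self {S : Finset (Fin m × Fin n)} {i : Fin m} (h : i ∉ eqRows S) :
    offRow S i = S := by
  unfold offRow
  rw [Finset.filter_eq_self]
  intro p hp hpi
  exact h (Finset.mem_image.2 ⟨p, hp, hpi⟩)

theorem rowParity_empty (y : Fin n → Bool) : rowParity (∅ : Finset (Fin n)) y = false := by
  simp [rowParity]

/-- The equations of `E` touching row `i`. -/
def touching (E : AffSys m n) (i : Fin m) : AffSys m n := E.filter fun e => i ∈ eqRows e.1

theorem length_touching (E : AffSys m n) (i : Fin m) : (touching E i).length = rowLoad E i := rfl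

/-- Row surgery with the TOUCHING equations only: if `X ⊨ E` and `y` satisfies the row-`i` restriction
of the equations touching row `i`, then `setRow X i y ⊨ E`. -/
theorem sat_setRow_of_touching {E : AffSys m n} {X : Fin m × Fin n → Bool} (hX : Sat E X) (i : Fin m)
    {y : Fin n → Bool} (hy : ∀ e ∈ restrictRow (touching E i) i X, rowParity e.1 y = e.2) :
    Sat E (setRow X i y) := by
  intro e he
  rw [parityOn_setRow]
  by_cases ht : i ∈ eqRows e.1
  · have hmem : (rowSupp e.1 i, Bool.xor e.2 (parityOn (offRow e.1 i) X))
        ∈ restrictRow (touching E i) i X := by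
      simp only [restrictRow, touching, List.mem_map, List.mem_filter, decide_eq_true_eq]
      exact ⟨e, ⟨he, ht⟩, rfl⟩
    have h1 := hy _ hmem
    simp only at h1
    rw [h1]
    cases e.2 <;> cases parityOn (offRow e.1 i) X <;> rfl
  · rw [rowSupp_eq_empty ht, offRow_eq_self ht, rowParity_empty, hX e he]
    cases e.2 <;> rfl

/-- The current row satisfies its own restriction. -/
theorem restrictRow_row_self {E : AffSys m n} {X : Fin m × Fin n → Bool} (hX : Sat E X) (i : Fin m) :
    ∀ e ∈ restrictRow (touching E i) i X, rowParity e.1 (row X i) = e.2 := by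
  intro e' he'
  simp only [restrictRow, List.mem_map] at he'
  obtain ⟨e, he, rfl⟩ := he'
  have heE : e ∈ E := (List.mem_filter.1 he).1
  have h1 := hX e heE
  have h2 : parityOn e.1 (setRow X i (row X i)) = e.2 := by
    have : setRow X i (row X i) = X := by
      funext p
      rcases p with ⟨i', j⟩
      by_cases h : i' = i
      · subst h; simp [setRow, row]
      · simp [setRow, h]
    rw [this]; exact h1
  rw [parityOn_setRow] at h2
  simp only
  rw [← h2]
  cases rowParity (rowSupp e.1 i) (row X i) <;> cases parityOn (offRow e.1 i) X <;> rfl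

/-- **S3 holds**: per-row label-universality of an `r`-generic non-constant `g` with budget `n − r − 1`
equations PER ROW (for every number of rows). -/
theorem perRowLUOfGeneric_holds : PerRowLUOfGeneric := by
  intro m n r g hg hgen E hload hsat v
  obtain ⟨u, w, hu, hw⟩ := hg
  have key : ∀ k, k ≤ m → ∃ X, Sat E X ∧ ∀ i : Fin m, i.val < k → g (row X i) = v i := by
    intro k
    induction k with
    | zero =>
      intro _
      obtain ⟨X, hX⟩ := hsat
      exact ⟨X, hX, fun i hi => absurd hi (Nat.not_lt_zero _)⟩
    | succ k ih =>
      intro hk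
      obtain ⟨X, hX, hlab⟩ := ih (by omega)
      obtain ⟨i, hi⟩ : ∃ i : Fin m, i.val = k := ⟨⟨k, by omega⟩, rfl⟩
      -- a new row `y` with label `v i` satisfying the touching restriction
      have hy : ∃ y : Fin n → Bool,
          (∀ e ∈ restrictRow (touching E i) i X, rowParity e.1 y = e.2) ∧ g y = v i := by
        by_cases h0 : rowLoad E i = 0
        · -- no equation touches row `i`: any row will do
          have hnil : restrictRow (touching E i) i X = [] := by
            have : touching E i = [] := List.eq_nil_of_length_eq_zero (by rw [length_touching]; exact h0)
            simp [restrictRow, this]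
          cases hvi : v i
          · exact ⟨w, by simp [hnil], hw⟩
          · exact ⟨u, by simp [hnil], hu⟩
        · have hEi : (restrictRow (touching E i) i X).length + r + 1 ≤ n := by
            simp only [restrictRow, List.length_map, length_touching]
            have := hload i
            omega
          exact hgen _ hEi ⟨row X i, restrictRow_row_self hX i⟩ (v i)
      obtain ⟨y, hy, hgy⟩ := hy
      refine ⟨setRow X i y, sat_setRow_of_touching hX i hy, fun i' hi' => ?_⟩
      by_cases h : i' = i
      · subst h; simpa using hgy
      · rw [row_setRow_of_ne _ _ h]
        have : i'.val ≠ k := fun hh => h (Fin.ext (hh.trans hi.symm))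
        exact hlab i' (by omega)
  obtain ⟨X, hX, hlab⟩ := key m le_rfl
  exact ⟨X, hX, funext fun i => by simpa using hlab i i.isLt⟩

/-! ### S2 PROVED: fibred realisability (the `E`-fibred form of M3's `exists_X` / `exists_X_row`)
In the LRAD state rows are TYPED: an affine system `E` (per-row loads `≤ q`) touches only rows whose row-set
is unconstrained (`algebraic`), the other rows carry M3's arbitrary row-sets `S i` and no equation.  Given
per-row label-universality, every coordinatewise-realisable label vector is realised by a matrix satisfying
`E`, with all rows in their sets and one untouched row prescribed. -/

theorem parityOn_congr {S : Finset (Fin m × Fin n)} {X X' : Fin m × Fin n → Bool}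
    (h : ∀ p ∈ S, X p = X' p) : parityOn S X = parityOn S X' := by
  unfold parityOn
  rw [Finset.filter_congr (fun p hp => by rw [h p hp])]

theorem one_le_rowLoad_of_mem {E : AffSys m n} {e : Finset (Fin m × Fin n) × Bool} (he : e ∈ E)
    {i : Fin m} (hi : i ∈ eqRows e.1) : 1 ≤ rowLoad E i := by
  unfold rowLoad
  exact List.length_pos_iff_exists_mem.2 ⟨e, List.mem_filter.2 ⟨he, by simpa using hi⟩⟩

/-- **S2 (fibred realisability).** -/
theorem exists_X_fibred {g : (Fin n → Bool) → Bool} {q : ℕ} (hLU : PerRowLU g m q) {E : AffSys m n}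
    (hload : ∀ i, rowLoad E i ≤ q) (hsat : ∃ X, Sat E X) (S : Fin m → Set (Fin n → Bool))
    (htyped : ∀ i, rowLoad E i = 0 ∨ S i = Set.univ) {a : Fin m → Bool}
    (ha : ∀ i, ∃ x ∈ S i, g x = a i) {i₀ : Fin m} (hi₀ : rowLoad E i₀ = 0) {x : Fin n → Bool}
    (hx : x ∈ S i₀) (hgx : g x = a i₀) :
    ∃ X, Sat E X ∧ rowLabels g X = a ∧ (∀ i, row X i ∈ S i) ∧ row X i₀ = x := by
  classical
  obtain ⟨X₀, hX₀, hlab₀⟩ := hLU E hload hsat a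
  choose y hyS hyg using ha
  let y' : Fin m → Fin n → Bool := fun i => if i = i₀ then x else y i
  have hy'S : ∀ i, y' i ∈ S i := by
    intro i
    by_cases h : i = i₀
    · subst h; simpa [y'] using hx
    · simpa [y', h] using hyS i
  have hy'g : ∀ i, g (y' i) = a i := by
    intro i
    by_cases h : i = i₀
    · subst h; simpa [y'] using hgx
    · simpa [y', h] using hyg i
  let X : Fin m × Fin n → Bool := fun p => if rowLoad E p.1 = 0 then y' p.1 p.2 else X₀ p
  have hrow0 : ∀ i, rowLoad E i = 0 → row X i = y' i := fun i h => funext fun j => by simp [X, h]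
  have hrow1 : ∀ i, rowLoad E i ≠ 0 → row X i = row X₀ i := fun i h => funext fun j => by simp [X, h]
  refine ⟨X, ?_, ?_, ?_, ?_⟩
  · intro e he
    rw [← hX₀ e he]
    apply parityOn_congr
    intro p hp
    have h1 : 1 ≤ rowLoad E p.1 := one_le_rowLoad_of_mem he (Finset.mem_image.2 ⟨p, hp, rfl⟩)
    have h1' : rowLoad E p.1 ≠ 0 := by omega
    simp [X, h1']
  · funext i
    rw [rowLabels_apply]
    by_cases h : rowLoad E i = 0
    · rw [hrow0 i h, hy'g]
    · rw [hrow1 i h, ← rowLabels_apply g X₀ i, hlab₀]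
  · intro i
    rcases htyped i with h | h
    · rw [hrow0 i h]; exact hy'S i
    · rw [h]; exact Set.mem_univ _
  · rw [hrow0 i₀ hi₀]; simp [y']

/-- S2 without a prescribed row (M3's `exists_X`, fibred); needs one untouched row only to instantiate the
prescribed-row version — stated here directly. -/
theorem exists_X_fibred' {g : (Fin n → Bool) → Bool} {q : ℕ} (hLU : PerRowLU g m q) {E : AffSys m n}
    (hload : ∀ i, rowLoad E i ≤ q) (hsat : ∃ X, Sat E X) (S : Fin m → Set (Fin n → Bool))
    (htyped : ∀ i, rowLoad E i = 0 ∨ S i = Set.univ) {a : Fin m → Bool}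
    (ha : ∀ i, ∃ x ∈ S i, g x = a i) :
    ∃ X, Sat E X ∧ rowLabels g X = a ∧ ∀ i, row X i ∈ S i := by
  classical
  obtain ⟨X₀, hX₀, hlab₀⟩ := hLU E hload hsat a
  choose y hyS hyg using ha
  let X : Fin m × Fin n → Bool := fun p => if rowLoad E p.1 = 0 then y p.1 p.2 else X₀ p
  have hrow0 : ∀ i, rowLoad E i = 0 → row X i = y i := fun i h => funext fun j => by simp [X, h]
  have hrow1 : ∀ i, rowLoad E i ≠ 0 → row X i = row X₀ i := fun i h => funext fun j => by simp [X, h]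
  refine ⟨X, ?_, ?_, ?_⟩
  · intro e he
    rw [← hX₀ e he]
    apply parityOn_congr
    intro p hp
    have h1 : 1 ≤ rowLoad E p.1 := one_le_rowLoad_of_mem he (Finset.mem_image.2 ⟨p, hp, rfl⟩)
    have h1' : rowLoad E p.1 ≠ 0 := by omega
    simp [X, h1']
  · funext i
    rw [rowLabels_apply]
    by_cases h : rowLoad E i = 0
    · rw [hrow0 i h, hyg]
    · rw [hrow1 i h, ← rowLabels_apply g X₀ i, hlab₀]
  · intro i
    rcases htyped i with h | h
    · rw [hrow0 i h]; exact hyS i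
    · rw [h]; exact Set.mem_univ _

end PerRowBudget

/-! ## §6 S0 PROVED: one inner function that is BOTH Karchmer–Wigderson-depth-hard AND affine-generic

The LRAD recipe (memo §5) needs a single `g` carrying both hardness notions: KW-depth `≥ n − O(log n)`
(for the combinatorial rows, as in M3) and `AffGeneric g (2 (log₂ n + 1))` (for the algebraic rows, as in
L⁺).  Both existence proofs in the tree are counts against `2^{2^n}`; here they are made QUANTITATIVE and
added: functions of `B₂`-circuit size `≤ S` (`S + 2 = 2^{n − log₂ n − 4}`) number `≤ #Code(n,S) <
2^{2^{n−1}}` (the tree's Riordan–Shannon count, `CircuitCount.card_code_le`, one exponent sharper than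
`card_code_lt_two_pow_two_pow` states it), the affine-degenerate ones number `≤ 2^{2^n − 1}` (g18's count,
one bit sharper than stated there), and `2^{2^{n−1}} + 2^{2^n−1} ≤ 2^{2^n}`.  A function outside both sets
is non-constant, affine-generic, and every protocol for its KW game has depth `≥ n − log₂ n − 5`
(`KWTree.circuitSizeOver_B2_lt_two_pow_of_solves`).  Counting helpers `rowParity_insert … card_const_on_le`
are [verbatim P4g18 §6]. -/
section JointExistence

open Literature.Computability.MetaComplexity

variable {n : ℕ}

theorem rowParity_insert {S : Finset (Fin n)} {j : Fin n} (h : j ∉ S) (x : Fin n → Bool) :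
    rowParity (insert j S) x = Bool.xor (x j) (rowParity S x) := by
  unfold rowParity
  rw [Finset.filter_insert]
  by_cases hx : x j = true
  · rw [if_pos hx, Finset.card_insert_of_notMem (by simp [Finset.mem_filter, h]), Nat.bodd_add, hx]
    cases Nat.bodd (S.filter fun j => x j = true).card <;> rfl
  · rw [if_neg hx]
    simp only [Bool.not_eq_true] at hx
    rw [hx]
    cases Nat.bodd (S.filter fun j => x j = true).card <;> rfl

/-- Parity of a pointwise xor of two vectors. -/
theorem rowParity_bxor (S : Finset (Fin n)) (x y : Fin n → Bool) :
    rowParity S (fun j => Bool.xor (x j) (y j)) = Bool.xor (rowParity S x) (rowParity S y) := by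
  induction S using Finset.induction_on with
  | empty => simp [rowParity]
  | insert j S hj ih =>
    rw [rowParity_insert hj, rowParity_insert hj, rowParity_insert hj, ih]
    cases x j <;> cases y j <;> cases rowParity S x <;> cases rowParity S y <;> rfl

/-- A satisfiable system of `k` parity equations on `{0,1}^n` has at least `2^{n-k}` solutions. -/
theorem two_pow_le_card_sol (E : List (Finset (Fin n) × Bool))
    (hsat : ∃ x, ∀ e ∈ E, rowParity e.1 x = e.2) :
    2 ^ (n - E.length) ≤
      (Finset.univ.filter fun x : Fin n → Bool => ∀ e ∈ E, rowParity e.1 x = e.2).card := by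
  induction E with
  | nil => simp
  | cons e E ih =>
    obtain ⟨x₀, hx₀⟩ := hsat
    have hx₀E : ∀ e' ∈ E, rowParity e'.1 x₀ = e'.2 := fun e' he' => hx₀ e' (List.mem_cons_of_mem _ he')
    have hx₀e : rowParity e.1 x₀ = e.2 := hx₀ e List.mem_cons_self
    have ih' := ih ⟨x₀, hx₀E⟩
    set T := Finset.univ.filter (fun x : Fin n → Bool => ∀ e' ∈ E, rowParity e'.1 x = e'.2) with hT
    have hT1eq : (Finset.univ.filter fun x : Fin n → Bool => ∀ e' ∈ e :: E, rowParity e'.1 x = e'.2)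
        = T.filter fun x => rowParity e.1 x = e.2 := by
      ext x
      simp only [Finset.mem_filter, Finset.mem_univ, true_and, List.forall_mem_cons, hT]
      exact and_comm
    rw [hT1eq]
    have hsplit := Finset.card_filter_add_card_filter_not
      (s := T) (fun x => rowParity e.1 x = e.2)
    have hle : (T.filter fun x => ¬ rowParity e.1 x = e.2).card
        ≤ (T.filter fun x => rowParity e.1 x = e.2).card := by
      by_cases h0 : (T.filter fun x => ¬ rowParity e.1 x = e.2) = ∅
      · rw [h0]; simp
      · obtain ⟨x₁, hx₁⟩ := Finset.nonempty_iff_ne_empty.mpr h0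
        simp only [Finset.mem_filter, hT, Finset.mem_univ, true_and] at hx₁
        apply Finset.card_le_card_of_injOn
          (fun x : Fin n → Bool => fun j => Bool.xor (Bool.xor (x j) (x₀ j)) (x₁ j))
        · intro x hx
          simp only [Finset.coe_filter, Finset.mem_filter, Finset.mem_univ, true_and, hT,
            Set.mem_setOf_eq] at hx ⊢
          refine ⟨fun e' he' => ?_, ?_⟩
          · rw [rowParity_bxor e'.1 (fun j => Bool.xor (x j) (x₀ j)) x₁, rowParity_bxor,
              hx.1 e' he', hx₀E e' he', hx₁.1 e' he']
            cases e'.2 <;> rfl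
          · rw [rowParity_bxor e.1 (fun j => Bool.xor (x j) (x₀ j)) x₁, rowParity_bxor, hx₀e]
            have h1 := hx.2
            have h2 := hx₁.2
            revert h1 h2
            cases rowParity e.1 x <;> cases rowParity e.1 x₁ <;> cases e.2 <;> simp
        · intro x _ x' _ h
          funext j
          have := congr_fun h j
          simp only at this
          revert this
          cases x j <;> cases x' j <;> cases x₀ j <;> cases x₁ j <;> simp
    have h1 : 1 ≤ (T.filter fun x => rowParity e.1 x = e.2).card := by
      apply Finset.card_pos.mpr
      refine ⟨x₀, ?_⟩
      rw [Finset.mem_filter, hT]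
      exact ⟨by simp only [Finset.mem_filter, Finset.mem_univ, true_and]; exact hx₀E, hx₀e⟩
    rcases Nat.eq_zero_or_pos (n - E.length) with hz | hpos
    · have : n - (e :: E).length = 0 := by simp only [List.length_cons]; omega
      rw [this]; simpa using h1
    · have heq : n - E.length = (n - (e :: E).length) + 1 := by simp only [List.length_cons]; omega
      rw [heq, pow_succ] at ih'
      omega

/-- Boolean functions on `{0,1}^n` that are constant `= b` on `T` number at most `2^{2^n − |T|}`. -/
theorem card_const_on_le (T : Finset (Fin n → Bool)) (b : Bool) :
    (Finset.univ.filter fun g : (Fin n → Bool) → Bool => ∀ x ∈ T, g x = b).card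
      ≤ 2 ^ (2 ^ n - T.card) := by
  have hc : Fintype.card ({x : Fin n → Bool // x ∉ T} → Bool) = 2 ^ (2 ^ n - T.card) := by
    rw [Fintype.card_fun, Fintype.card_bool, Fintype.card_subtype_compl, Fintype.card_coe]
    simp [Fintype.card_bool, Fintype.card_fin]
  rw [← hc, ← Finset.card_univ]
  apply Finset.card_le_card_of_injOn (fun g => fun x : {x : Fin n → Bool // x ∉ T} => g x.1)
  · intro g _; simp
  · intro g hg g' hg' h
    simp only [Finset.coe_filter, Finset.mem_univ, true_and, Set.mem_setOf_eq] at hg hg'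
    funext x
    by_cases hx : x ∈ T
    · rw [hg x hx, hg' x hx]
    · exact congr_fun h ⟨x, hx⟩

/-- The affine-degenerate functions are at most HALF of all functions (g18's STUB-2 count, sharpened by
one bit): outside a set of `≤ 2^{2^n − 1}` functions every `g` is `2 (log₂ n + 1)`-generic. -/
theorem exists_affBad (hrn : 2 * (Nat.log 2 n + 1) + 1 ≤ n) :
    ∃ Bad : Finset ((Fin n → Bool) → Bool), Bad.card ≤ 2 ^ (2 ^ n - 1) ∧
      ∀ g, g ∉ Bad → AffGeneric g (2 * (Nat.log 2 n + 1)) := by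
  classical
  set L := Nat.log 2 n with hL
  set r := 2 * (L + 1) with hr
  set N := n - r - 1 with hN
  have hNr : n - N = r + 1 := by omega
  -- the bad set
  set SatR : List (Finset (Fin n) × Bool) → (Fin n → Bool) → Prop :=
    fun E x => ∀ e ∈ E, rowParity e.1 x = e.2 with hSatR
  set Piece : (Fin N → Finset (Fin n) × Bool) → Bool → Finset ((Fin n → Bool) → Bool) :=
    fun σ b => Finset.univ.filter fun g =>
      (∃ x, SatR (List.ofFn σ) x) ∧ ∀ x, SatR (List.ofFn σ) x → g x = b with hPiece
  set Bad : Finset ((Fin n → Bool) → Bool) :=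
    (Finset.univ : Finset (Fin N → Finset (Fin n) × Bool)).biUnion fun σ =>
      (Finset.univ : Finset Bool).biUnion fun b => Piece σ b with hBad
  -- each piece is small
  have hterm : ∀ (σ : Fin N → Finset (Fin n) × Bool) (b : Bool),
      (Piece σ b).card ≤ 2 ^ (2 ^ n - 2 ^ (r + 1)) := by
    intro σ b
    by_cases hσ : ∃ x, SatR (List.ofFn σ) x
    · set T := Finset.univ.filter (fun x => SatR (List.ofFn σ) x) with hT
      have hTc : 2 ^ (n - (List.ofFn σ).length) ≤ T.card := two_pow_le_card_sol _ hσ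
      rw [List.length_ofFn, hNr] at hTc
      calc (Piece σ b).card
          ≤ (Finset.univ.filter fun g : (Fin n → Bool) → Bool => ∀ x ∈ T, g x = b).card := by
            apply Finset.card_le_card
            intro g hg
            simp only [hPiece, Finset.mem_filter, Finset.mem_univ, true_and, hT] at hg ⊢
            intro x hx
            exact hg.2 x hx
        _ ≤ 2 ^ (2 ^ n - T.card) := card_const_on_le T b
        _ ≤ 2 ^ (2 ^ n - 2 ^ (r + 1)) := Nat.pow_le_pow_right (by norm_num) (by omega)
    · have : Piece σ b = ∅ := by
        rw [hPiece]
        apply Finset.filter_eq_empty_iff.mpr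
        intro g _ h
        exact hσ h.1
      rw [this]; simp
  -- the bad set is not everything
  have hlog : n < 2 ^ (L + 1) := Nat.lt_pow_succ_log_self one_lt_two n
  have hcardσ : Fintype.card (Fin N → Finset (Fin n) × Bool) = 2 ^ ((n + 1) * N) := by
    rw [Fintype.card_fun, Fintype.card_prod, Fintype.card_finset, Fintype.card_bool,
      Fintype.card_fin, Fintype.card_fin, ← pow_succ, ← pow_mul]
  have hexp : (n + 1) * N + 1 < 2 ^ (r + 1) := by
    have hN3 : N + 3 ≤ n := by omega
    have h1 : (n + 1) * N + 2 ≤ n * n := by nlinarith [Nat.mul_le_mul_left (n + 1) hN3]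
    have h2 : n * n < 2 ^ (L + 1) * 2 ^ (L + 1) := Nat.mul_lt_mul'' hlog hlog
    have h3 : 2 ^ (L + 1) * 2 ^ (L + 1) ≤ 2 ^ (r + 1) := by
      rw [← pow_add]; exact Nat.pow_le_pow_right (by norm_num) (by omega)
    exact lt_of_lt_of_le (lt_of_lt_of_le (Nat.lt_succ_of_le le_rfl) h1) (le_trans h2.le h3) |>.trans_le le_rfl
  have hpow : 2 ^ (r + 1) ≤ 2 ^ n := Nat.pow_le_pow_right (by norm_num) hrn
  have hA : 2 ^ (2 ^ n) = 2 ^ (2 ^ (r + 1)) * 2 ^ (2 ^ n - 2 ^ (r + 1)) := by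
    rw [← pow_add]; congr 1; omega
  have hone : 1 ≤ 2 ^ (r + 1) := Nat.one_le_two_pow
  have hBadle : Bad.card ≤ 2 ^ (2 ^ n - 1) := by
    calc Bad.card ≤ ∑ σ : Fin N → Finset (Fin n) × Bool, ∑ b : Bool, (Piece σ b).card := by
            refine Finset.card_biUnion_le.trans ?_
            apply Finset.sum_le_sum; intro σ _; exact Finset.card_biUnion_le
      _ ≤ ∑ σ : Fin N → Finset (Fin n) × Bool, ∑ b : Bool, 2 ^ (2 ^ n - 2 ^ (r + 1)) := by
            apply Finset.sum_le_sum; intro σ _; apply Finset.sum_le_sum; intro b _; exact hterm σ b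
      _ = 2 ^ ((n + 1) * N) * (2 * 2 ^ (2 ^ n - 2 ^ (r + 1))) := by
            simp only [Finset.sum_const, Finset.card_univ, hcardσ, Fintype.card_bool, smul_eq_mul]
      _ = 2 ^ ((n + 1) * N + 1) * 2 ^ (2 ^ n - 2 ^ (r + 1)) := by ring
      _ ≤ 2 ^ (2 ^ (r + 1) - 1) * 2 ^ (2 ^ n - 2 ^ (r + 1)) :=
            Nat.mul_le_mul_right _ (Nat.pow_le_pow_right (by norm_num) (by omega))
      _ = 2 ^ (2 ^ n - 1) := by rw [← pow_add]; congr 1; omega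
  refine ⟨Bad, hBadle, fun g hg => ?_⟩
  intro E hE hsat β
  by_contra hc
  push Not at hc
  apply hg
  -- pad `E` to length `N`
  let σ : Fin N → Finset (Fin n) × Bool :=
    fun t => if h : t.val < E.length then E[t.val] else (∅, false)
  have hiff : ∀ x, SatR (List.ofFn σ) x ↔ ∀ e ∈ E, rowParity e.1 x = e.2 := by
    intro x
    simp only [hSatR]
    constructor
    · intro h e he
      obtain ⟨i, hi, rfl⟩ := List.mem_iff_getElem.1 he
      have ht : (⟨i, by omega⟩ : Fin N).val < E.length := hi
      have := h (σ ⟨i, by omega⟩) (List.mem_ofFn.2 ⟨_, rfl⟩)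
      simp only [σ, dif_pos hi] at this
      exact this
    · intro h e' he'
      obtain ⟨t, rfl⟩ := List.mem_ofFn.1 he'
      by_cases ht : t.val < E.length
      · simp only [σ, dif_pos ht]
        exact h _ (List.getElem_mem ht)
      · simp [σ, dif_neg ht, rowParity]
  simp only [hBad, Finset.mem_biUnion, Finset.mem_univ, true_and]
  refine ⟨σ, !β, ?_⟩
  simp only [hPiece, Finset.mem_filter, Finset.mem_univ, true_and]
  refine ⟨?_, fun x hx => ?_⟩
  · obtain ⟨x, hx⟩ := hsat
    exact ⟨x, (hiff x).2 hx⟩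
  · have := hc x ((hiff x).1 hx)
    revert this
    cases g x <;> cases β <;> simp

/-- Functions of `B₂`-circuit complexity `≤ S` are decodings of codes: at most `#Code(n,S)` of them. -/
theorem card_easy_le_card_code (n S : ℕ) :
    (Finset.univ.filter fun g : (Fin n → Bool) → Bool => circuitSizeOver B2 g ≤ S).card
      ≤ Fintype.card (CircuitCount.Code n S) := by
  classical
  calc (Finset.univ.filter fun g : (Fin n → Bool) → Bool => circuitSizeOver B2 g ≤ S).card
      ≤ (Finset.univ.image fun c : CircuitCount.Code n S => CircuitCount.decode c).card := by
        apply Finset.card_le_card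
        intro g hg
        simp only [Finset.mem_filter, Finset.mem_univ, true_and] at hg
        obtain ⟨C, hB, hC, hsize⟩ := exists_computes_B2_size_eq_holds g
        obtain ⟨c, hc⟩ := CircuitCount.exists_code C hB (hsize ▸ hg)
        refine Finset.mem_image.2 ⟨c, Finset.mem_univ _, ?_⟩
        rw [hc]; funext x; exact hC x
    _ ≤ Fintype.card (CircuitCount.Code n S) := Finset.card_image_le.trans (by rw [Finset.card_univ])

/-- `⌊log₂ n⌋ + 6 ≤ n` for `n ≥ 9` (the tree's private `log_two_add_six_le`, restated). -/
theorem log_two_add_six_le {n : ℕ} (hn : 9 ≤ n) : Nat.log 2 n + 6 ≤ n := by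
  have key : ∀ m : ℕ, 9 + m < 2 ^ (m + 4) := by
    intro m
    induction m with
    | zero => norm_num
    | succ m ih => rw [pow_succ]; omega
  obtain ⟨m, rfl⟩ : ∃ m, n = 9 + m := ⟨n - 9, by omega⟩
  have hlt : Nat.log 2 (9 + m) < m + 4 := Nat.log_lt_of_lt_pow (by omega) (key m)
  omega

/-- **Riordan–Shannon, one exponent sharper than the tree states it**: for `n ≥ 9` and
`S + 2 = 2^{n − ⌊log₂ n⌋ − 4}`, `#Code(n,S) < 2^{2^{n−1}}` (same proof as
`card_code_lt_two_pow_two_pow`, which discards the last factor of two). -/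
theorem card_code_lt_two_pow_two_pow_pred {n S : ℕ} (hn : 9 ≤ n)
    (hS : S + 2 = 2 ^ (n - (Nat.log 2 n + 4))) :
    Fintype.card (CircuitCount.Code n S) < 2 ^ 2 ^ (n - 1) := by
  set t := Nat.log 2 n + 4 with ht
  have htn : t + 2 ≤ n := by have := log_two_add_six_le hn; omega
  set M := n + S + 1 with hM
  have h16 : (S + 1) * M ≤ 16 * M ^ 2 := by nlinarith
  have hcard : Fintype.card (CircuitCount.Code n S) ≤ (16 * M ^ 2) ^ (S + 1) := by
    calc Fintype.card (CircuitCount.Code n S)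
        ≤ (S + 1) * (16 * M ^ 2) ^ S * M := CircuitCount.card_code_le n S
      _ = (16 * M ^ 2) ^ S * ((S + 1) * M) := by ring
      _ ≤ (16 * M ^ 2) ^ S * (16 * M ^ 2) := Nat.mul_le_mul_left _ h16
      _ = (16 * M ^ 2) ^ (S + 1) := by ring
  have hS1 : S + 2 ≤ 2 ^ (n - 1) := by
    rw [hS]; exact Nat.pow_le_pow_right (by norm_num) (by omega)
  have hMle : M ≤ 2 ^ n := by
    have h2 : 2 ^ n = 2 * 2 ^ (n - 1) := by
      rw [← pow_succ']; congr 1; omega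
    have hn1 : n ≤ 2 ^ (n - 1) := by
      have := Nat.lt_two_pow_self (n := n - 1)
      omega
    omega
  have h16M : 16 * M ^ 2 ≤ 2 ^ (2 * n + 4) := by
    have : 2 ^ (2 * n + 4) = 16 * (2 ^ n) ^ 2 := by ring
    rw [this]
    gcongr
  have hlog : n < 2 ^ (Nat.log 2 n + 1) := Nat.lt_pow_succ_log_self (by norm_num) n
  have h2n4 : 2 * n + 4 ≤ 2 ^ (t - 1) := by
    have : 2 ^ (t - 1) = 4 * 2 ^ (Nat.log 2 n + 1) := by
      rw [ht, show Nat.log 2 n + 4 - 1 = (Nat.log 2 n + 1) + 2 by omega, pow_add]; ring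
    omega
  have hexp : (2 * n + 4) * (S + 1) < 2 ^ (n - 1) := by
    have hS' : S + 1 < 2 ^ (n - t) := by omega
    calc (2 * n + 4) * (S + 1) ≤ 2 ^ (t - 1) * (S + 1) := Nat.mul_le_mul_right _ h2n4
      _ < 2 ^ (t - 1) * 2 ^ (n - t) := Nat.mul_lt_mul_of_pos_left hS' (by positivity)
      _ = 2 ^ (n - 1) := by rw [← pow_add]; congr 1; omega
  calc Fintype.card (CircuitCount.Code n S) ≤ (16 * M ^ 2) ^ (S + 1) := hcard
    _ ≤ (2 ^ (2 * n + 4)) ^ (S + 1) := Nat.pow_le_pow_left h16M _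
    _ = 2 ^ ((2 * n + 4) * (S + 1)) := by rw [← pow_mul]
    _ < 2 ^ 2 ^ (n - 1) := Nat.pow_lt_pow_right (by norm_num) hexp

theorem two_mul_add_three_le_two_pow {L : ℕ} (h : 4 ≤ L) : 2 * L + 3 ≤ 2 ^ L := by
  induction L, h using Nat.le_induction with
  | base => norm_num
  | succ L hL ih =>
    have : 1 ≤ 2 ^ L := Nat.one_le_two_pow
    rw [pow_succ]; omega

/-- **S0 holds**: for every `n ≥ 1` there is a non-constant `g : {0,1}^n → {0,1}` which is
`2 (log₂ n + 1)`-affine-generic (`AffGeneric`, L⁺'s hypothesis) AND whose Karchmer–Wigderson game has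
protocol depth `≥ n − 8 (log₂ n + 1)` (M3's hypothesis) — the joint inner function the LRAD adversary needs. -/
theorem jointHardGeneric_exists : ∃ c : ℕ, ∀ n : ℕ, 1 ≤ n → ∃ g : (Fin n → Bool) → Bool,
    (∃ u v, g u = true ∧ g v = false) ∧ AffGeneric g (2 * (Nat.log 2 n + 1)) ∧
    ∀ P : Literature.Computability.Complexity.KWTree (Fin n), P.Solves g →
      n ≤ P.depth + c * (Nat.log 2 n + 1) := by
  classical
  refine ⟨8, fun n hn => ?_⟩
  have hlog : n < 2 ^ (Nat.log 2 n + 1) := Nat.lt_pow_succ_log_self one_lt_two n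
  by_cases hsmall : n ≤ 8
  · -- small `n`: a dictator; genericity only has to handle the empty system
    have hL : n ≤ 2 * Nat.log 2 n + 3 := by
      rcases Nat.lt_or_ge (Nat.log 2 n) 3 with h3 | h3
      · generalize hLn : Nat.log 2 n = L at hlog h3 ⊢
        interval_cases L <;> simp at hlog <;> omega
      · omega
    refine ⟨fun x => x ⟨0, by omega⟩, ⟨fun _ => true, fun _ => false, rfl, rfl⟩, ?_, ?_⟩
    · intro E hE hsat β
      have hE0 : E = [] := List.eq_nil_of_length_eq_zero (by omega)
      subst hE0
      exact ⟨fun _ => β, fun e he => by simp at he, rfl⟩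
    · intro P _
      have := Nat.zero_le P.depth
      nlinarith [Nat.zero_le (Nat.log 2 n)]
  have hn9 : 9 ≤ n := by omega
  set L := Nat.log 2 n with hLdef
  have hL3 : 3 ≤ L := by
    by_contra h
    have : 2 ^ (L + 1) ≤ 2 ^ 3 := Nat.pow_le_pow_right (by norm_num) (by omega)
    omega
  have hpowL : 2 ^ L ≤ n := by rw [hLdef]; exact Nat.pow_log_le_self 2 (by omega)
  have hrn : 2 * (L + 1) + 1 ≤ n := by
    rcases eq_or_lt_of_le hL3 with h | h
    · omega
    · have := two_mul_add_three_le_two_pow (L := L) (by omega)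
      omega
  -- the two bad sets
  obtain ⟨Bad, hBad, hgenBad⟩ := exists_affBad (n := n) (by rw [← hLdef]; exact hrn)
  set t := L + 4 with ht
  have htn : t + 2 ≤ n := by have := log_two_add_six_le hn9; omega
  have hpow2 : 4 ≤ 2 ^ (n - t) := by
    calc (4 : ℕ) = 2 ^ 2 := by norm_num
      _ ≤ 2 ^ (n - t) := Nat.pow_le_pow_right (by norm_num) (by omega)
  set S := 2 ^ (n - t) - 2 with hSdef
  have hS : S + 2 = 2 ^ (n - (Nat.log 2 n + 4)) := by rw [← hLdef, ← ht]; omega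
  set Easy : Finset ((Fin n → Bool) → Bool) :=
    Finset.univ.filter fun g => circuitSizeOver B2 g ≤ S with hEasy
  have hEasylt : Easy.card < 2 ^ 2 ^ (n - 1) :=
    (card_easy_le_card_code n S).trans_lt (card_code_lt_two_pow_two_pow_pred hn9 hS)
  have hhalf : 2 ^ 2 ^ (n - 1) ≤ 2 ^ (2 ^ n - 1) := by
    apply Nat.pow_le_pow_right (by norm_num)
    have h2 : 2 ^ n = 2 * 2 ^ (n - 1) := by rw [← pow_succ']; congr 1; omega
    have : 1 ≤ 2 ^ (n - 1) := Nat.one_le_two_pow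
    omega
  have h2n : 1 ≤ 2 ^ n := Nat.one_le_two_pow
  have huniv : (Finset.univ : Finset ((Fin n → Bool) → Bool)).card = 2 ^ (2 ^ n) := by
    simp [Finset.card_univ, Fintype.card_bool, Fintype.card_fin]
  have hunion : (Easy ∪ Bad).card < (Finset.univ : Finset ((Fin n → Bool) → Bool)).card := by
    rw [huniv]
    calc (Easy ∪ Bad).card ≤ Easy.card + Bad.card := Finset.card_union_le _ _
      _ < 2 ^ (2 ^ n - 1) + 2 ^ (2 ^ n - 1) := by omega
      _ = 2 ^ (2 ^ n) := by rw [← two_mul, ← pow_succ']; congr 1; omega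
  obtain ⟨g, -, hg⟩ := Finset.exists_mem_notMem_of_card_lt_card hunion
  rw [Finset.mem_union, not_or] at hg
  have hlt : S < circuitSizeOver B2 g := by
    have := hg.1
    simp only [hEasy, Finset.mem_filter, Finset.mem_univ, true_and, not_le] at this
    exact this
  -- `g` is not constant: constants have circuits of size `1 ≤ S`
  have hS2 : 2 ≤ S := by omega
  have hne : (∃ a, g a = true) ∧ ∃ b, g b = false := by
    by_contra hcon
    have hconst : ∃ b : Bool, g = fun _ => b := by
      by_cases h1 : ∃ a, g a = true
      · refine ⟨true, funext fun x => ?_⟩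
        by_contra hx
        exact hcon ⟨h1, x, by simpa using hx⟩
      · refine ⟨false, funext fun x => ?_⟩
        by_contra hx
        exact h1 ⟨x, by simpa using hx⟩
    obtain ⟨b, hb⟩ := hconst
    have h1 : circuitSizeOver B2 g ≤ 1 := by rw [hb]; exact circuitSizeOver_B2_const_le _ b
    omega
  refine ⟨g, ?_, hgenBad g hg.2, fun P hP => ?_⟩
  · obtain ⟨⟨a, ha⟩, ⟨b, hb⟩⟩ := hne
    exact ⟨a, b, ha, hb⟩
  · have hdepth := P.circuitSizeOver_B2_lt_two_pow_of_solves hP hne.1 hne.2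
    have hle : 2 ^ (n - t) ≤ 2 ^ (P.depth + 1) := by omega
    have hnt : n - t ≤ P.depth + 1 := (Nat.pow_le_pow_iff_right (by norm_num)).mp hle
    omega

end JointExistence

/-! ## §7 The rung C1|LRAD reduced to ONE adversary statement (skeleton; every other piece proved here)

`LRADQuantitative` is the quantitative adversary bound the gluing of memo §5 should deliver (card
`row-typing-discipline`, First lemma, with the per-row hypothesis `PerRowLU` that §5 proves available):
label hardness `ℓ`, KW-depth `dg` of `g`, per-row affine budget `q`; every disciplined protocol for the
strong game has depth `≥ ℓ + min(dg, q − 1) − 2`.  `strongCompositionLRAD_of_quantitative` assembles the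
class statement `StrongCompositionLRAD` from it ALONE, using §5 (`perRowLUOfGeneric_holds`), §6
(`jointHardGeneric_exists`) and the tree's `liftRows` embedding for the budget-free small-`n` case. -/
section Assembly

/-- **The one remaining stub of the LRAD rung** (an adversary theorem; memo §5.3 is its step table).
Non-constancy of `f` is load-bearing (for constant `f` the leaf protocol solves the strong game vacuously,
cf. the disprover's `strongComposition_false_without_nonconst`); constant `g` forces `dg = 0`. -/
def LRADQuantitative : Prop :=
  ∀ (m n q dg ℓ : ℕ) (f : (Fin m → Bool) → Bool) (g : (Fin n → Bool) → Bool),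
    (∃ a b, f a = true ∧ f b = false) →
    (∀ R : KWTree (Fin n), R.Solves g → dg ≤ R.depth) → PerRowLU g m q → 1 ≤ q →
    Hard (f ⁻¹' {true}) (f ⁻¹' {false}) ℓ →
    ∀ P : KWTree (Fin m × Fin n), LRADisciplined g P → P.SolvesStrong f g →
      ℓ + min dg (q - 1) ≤ P.depth + 2

/-- **Assembly of the rung**: the adversary bound alone gives C1 on the disciplined class, with loss
`(c + 8) (log₂ (m n) + 1)` where `c` is the constant of `jointHardGeneric_exists`. -/
theorem strongCompositionLRAD_of_quantitative (hQ : LRADQuantitative) : StrongCompositionLRAD := by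
  obtain ⟨c, hc⟩ := jointHardGeneric_exists
  refine ⟨c + 8, fun m n hn f hf => ?_⟩
  obtain ⟨g, ⟨u, v, hu, hv⟩, hgen, hdepth⟩ := hc n hn
  refine ⟨g, fun P hP hsol => ?_⟩
  have hne : ∃ a b, f a = true ∧ f b = false := by
    obtain ⟨a, b, hab⟩ := hf
    cases ha : f a <;> cases hb : f b
    · rw [ha, hb] at hab; exact absurd rfl hab
    · exact ⟨b, a, hb, ha⟩
    · exact ⟨a, b, ha, hb⟩
    · rw [ha, hb] at hab; exact absurd rfl hab
  have hm : 0 < m := by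
    obtain ⟨a, b, hab⟩ := hf
    rcases Nat.eq_zero_or_pos m with h0 | h0
    · exfalso; subst h0; exact hab (congrArg f (funext fun i => i.elim0))
    · exact h0
  set L := Nat.log 2 (m * n) + 1 with hL
  have hLn : Nat.log 2 n + 1 ≤ L := by
    have : Nat.log 2 n ≤ Nat.log 2 (m * n) := Nat.log_mono_right (Nat.le_mul_of_pos_left n hm)
    omega
  set r := 2 * (Nat.log 2 n + 1) with hr
  set q := n - r - 1 with hq
  have hLU : PerRowLU g m q := perRowLUOfGeneric_holds m n r g ⟨u, v, hu, hv⟩ hgen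
  have e1 : (c + 8) * L = c * L + 8 * L := by ring
  have hcL : c * (Nat.log 2 n + 1) ≤ c * L := Nat.mul_le_mul_left _ hLn
  rcases Nat.eq_zero_or_pos q with hq0 | hq0
  · -- no affine budget (`n ≤ 2 log₂ n + 3`): the `liftRows` protocol already fits
    refine ⟨P.comap (KWTree.liftRows u v) (KWTree.liftRows u v) Prod.fst, KWTree.solves_comap_liftRows hsol hu hv, ?_⟩
    rw [KWTree.depth_comap]
    omega
  · set dg := n - c * (Nat.log 2 n + 1) with hdg
    have hKW : ∀ R : KWTree (Fin n), R.Solves g → dg ≤ R.depth := fun R hR => by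
      have := hdepth R hR; omega
    by_contra hcon
    push Not at hcon
    set ℓ := P.depth + (c + 8) * L + 1 - n with hℓ
    have hH : Hard (f ⁻¹' {true}) (f ⁻¹' {false}) ℓ := by
      intro Q hQ
      have hs : Q.Solves f := fun a b ha hb => hQ a (by simpa using ha) b (by simpa using hb)
      have := hcon Q hs
      omega
    have hmain := hQ m n q dg ℓ f g hne hKW hLU hq0 hH P hP hsol
    omega

end Assembly

/-! ## Invariant sketch for the stub (DEFINITIONS ONLY — a proposal for the lead, not registered stubs)

M3's state `(A, B, S, T)` (`LensNegationP5g17.lean` §2, vocabulary restated verbatim) FIBRED over one COMMON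
affine system `E` (L⁺, `LensBarrierP4g18.lean` §3) and a public row typing `τ` (this file's `RowType`):
a player may hold `XSetE A S E = {X : labels ∈ A, rows in S i, X ⊨ E}`; typing discipline `StateOK`:
non-algebraic rows carry no equation, non-combinatorial rows carry no row-set.  By S2 (`exists_X_fibred'`)
the realisable label columns of `XSetE` are M3's `AE A S` as long as the loads stay `≤ q` — fibrewise
independence — so the label bookkeeping (`AE`, `Alive`, `cst`, `Hard (AE A S) (AE B T) ℓ`) is M3's verbatim.
Proposed invariant `InvOnE` (M3's `InvOn` + per-row budget `k`): conclusion `ℓ + min K k ≤ depth + 2`.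
How `stub_lradQuantitative` should follow: root state `τ ≡ fresh`, `S = T ≡ univ`, `E = []`, `k = q`,
`A = 𝒜 = f⁻¹ 1`, `B = ℬ = f⁻¹ 0` (then `AE = A`, `AE = B` by non-constancy of `g`, which `PerRowLU` with
`m ≥ 1` implies), `r i α = dg`, `K = dg`; `ValidOnE` from `SolvesStrong`.  Step costs (memo §5.3): label
test — M3 (`ℓ` or `cst`); row test on a fresh/combinatorial row — M3 `row_step_alice/bob` (`K`); affine
test on fresh/algebraic rows — forced answer if `E`-dependent, else the equation joins `E` (loads `+1` on
its rows, `k − 1`), imposed on BOTH players; leaf in a non-algebraic row — M3 `inv_leaf`; leaf `(i, j)` in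
an algebraic row with `k ≥ 1` — add `X_{ij} = c` (S2 realises every label pair with equal entries:
contradiction with validity); `k = 0` — collapse with PRIVATE label-exact families from S2
(`P4g19.phase2_private`): the subtree solves `AE A S × AE B T`, so `depth ≥ ℓ = ℓ + min K 0`. -/
section InvariantSketch

variable {m n : ℕ}
variable (g : (Fin n → Bool) → Bool)

/-- The matrices one player may still hold in the fibred state. -/
def XSetE (A : Set (Fin m → Bool)) (S : Fin m → Set (Fin n → Bool)) (E : AffSys m n) :
    Set (Fin m × Fin n → Bool) :=
  {X | rowLabels g X ∈ A ∧ (∀ i, row X i ∈ S i) ∧ Sat E X}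

/-- [verbatim `LabelPublic.AE`] realisable label columns. -/
def AE (A : Set (Fin m → Bool)) (S : Fin m → Set (Fin n → Bool)) : Set (Fin m → Bool) :=
  {a | a ∈ A ∧ ∀ i, ∃ x ∈ S i, g x = a i}

/-- [verbatim `LabelPublic.RA`] one side of the row game of row `i` at orientation value `α`. -/
def RA (S : Fin m → Set (Fin n → Bool)) (i : Fin m) (α : Bool) : Set (Fin n → Bool) :=
  S i ∩ {x | g x = α}

/-- [verbatim `LabelPublic.Alive`] orientation `(i, α)` is still possible. -/
def Alive (A B : Set (Fin m → Bool)) (S T : Fin m → Set (Fin n → Bool)) (i : Fin m) (α : Bool) : Prop :=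
  (∃ a ∈ AE g A S, a i = α) ∧ (∃ b ∈ AE g B T, b i = !α)

/-- [verbatim `LabelPublic.cst`] `1` if all vectors of `E` agree at coordinate `i`, else `0`. -/
noncomputable def cst (E : Set (Fin m → Bool)) (i : Fin m) : ℕ := by
  classical exact if ∃ v, ∀ a ∈ E, a i = v then 1 else 0

/-- `P` is correct for the strong game on all input pairs the fibred state allows. -/
def ValidOnE (P : KWTree (Fin m × Fin n)) (A B : Set (Fin m → Bool)) (S T : Fin m → Set (Fin n → Bool))
    (E : AffSys m n) : Prop :=
  ∀ X ∈ XSetE g A S E, ∀ Y ∈ XSetE g B T E,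
    X (P.run X Y) ≠ Y (P.run X Y) ∧ rowLabels g X (P.run X Y).1 ≠ rowLabels g Y (P.run X Y).1

/-- Typing discipline of a state: only algebraic rows carry equations, only combinatorial rows carry
row-sets. -/
def StateOK (τ : Fin m → RowType) (S T : Fin m → Set (Fin n → Bool)) (E : AffSys m n) : Prop :=
  ∀ i, (τ i ≠ RowType.algebraic → rowLoad E i = 0) ∧
    (τ i ≠ RowType.combinatorial → S i = Set.univ ∧ T i = Set.univ)

/-- **Proposed invariant** for every disciplined subtree (M3's `InvOn` with the system `E`, the typing `τ`
and the per-row remaining budget `k`; `q` = the per-row label-universality budget of `g`). -/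
def InvOnE (𝒜 ℬ : Set (Fin m → Bool)) (q : ℕ) (P : KWTree (Fin m × Fin n)) : Prop :=
  ∀ (τ : Fin m → RowType) (A B : Set (Fin m → Bool)) (S T : Fin m → Set (Fin n → Bool))
    (E : AffSys m n) (k : ℕ),
    LRADisciplinedOn g τ P → StateOK τ S T E → A ⊆ 𝒜 → B ⊆ ℬ →
    (∃ X, Sat E X) → (∀ i, rowLoad E i + k ≤ q) →
    ValidOnE g P A B S T E → (∀ a ∈ AE g A S, ∀ b ∈ AE g B T, a ≠ b) →
    (AE g A S).Nonempty → (AE g B T).Nonempty →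
    ∀ (ℓ K : ℕ) (r : Fin m → Bool → ℕ), Hard (AE g A S) (AE g B T) ℓ →
      (∀ i α, τ i ≠ RowType.algebraic → Alive g A B S T i α →
        Hard (RA g S i α) (RA g T i (!α)) (r i α)) →
      (∀ i α, τ i ≠ RowType.algebraic → Alive g A B S T i α →
        K ≤ r i α + cst (AE g A S) i + cst (AE g B T) i) →
      ℓ + min K k ≤ P.depth + 2

/-- The statement the induction should establish (NOT registered as a stub: the lead may reshape the
state); `stub_lradQuantitative` is its root instance. -/
def InvariantTheorem : Prop :=
  ∀ (m n q : ℕ) (g : (Fin n → Bool) → Bool) (𝒜 ℬ : Set (Fin m → Bool)),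
    PerRowLU g m q → 1 ≤ q → ∀ P : KWTree (Fin m × Fin n), InvOnE g 𝒜 ℬ q P

end InvariantSketch

/-! ## §8  The gluing adversary — PROOF of `stub_lradQuantitative` (lead prover, line `lrad-gluing`)

M3's invariant induction (`LensNegationP5g17.lean` §1–§3; its rectangle and state lemmas are restated
verbatim below) run over the FIBRED state of the sketch above: both players' matrices satisfy ONE common
affine system `E` (as in L⁺, `LensBarrierP4g18.lean` §2), a public row typing `τ` obeys `StateOK`, and a
budget `k` satisfies `rowLoad E i + k ≤ q` on every row.  Invariant `InvAt`: `ℓ + min K k ≤ depth + 2`.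
Steps: label test — `Hard.split_alice/bob` (`ℓ − 1`); single-row test on a non-algebraic row — M3's
`row_step` verbatim on the row-set factor (`K − 1`, or `ℓ − 1` with a newly constant side); affine test on
non-combinatorial rows with `k ≥ 1` — the `E`-consistent answer joins `E` for BOTH players (`k − 1`; `A,
B, S, T`, hence `AE`, `Alive`, `cst`, are unchanged); `k = 0` — private collapse (`collapseE`: label-exact
private families from S2 turn the subtree into a protocol for `AE A S × AE B T`, so `ℓ ≤ depth`); leaf in
a row without equations — M3's `inv_leaf` through the fibred realisation S2; leaf `(i, j)` in a row that
carries equations (hence `S i = T i = univ`) with `k ≥ 1` — the pin `X_{ij} = c` joins `E` and S2 realises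
a valid pair with EQUAL `(i, j)` entries: contradiction.  Root: `τ ≡ fresh`, `S = T ≡ univ`, `E = []`,
`k = q`, `K = dg`, giving `ℓ + min dg q ≤ depth + 2` (a fortiori the stub's `min dg (q − 1)`). -/
section Gluing

/-! ### Rectangle lemmas [verbatim `LabelPublic` §1 of `LensNegationP5g17.lean`] -/
section RectLemmas

variable {ι : Type u}

theorem hard_zero (A B : Set (ι → Bool)) : Hard A B 0 := fun _ _ => Nat.zero_le _

/-- A rectangle solved by a leaf has no positive lower bound. -/
theorem Hard.eq_zero_of_leaf {A B : Set (ι → Bool)} {ℓ : ℕ} (h : Hard A B ℓ) {i : ι}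
    (hi : SolvesRect (KWTree.leaf i) A B) : ℓ = 0 := by
  have := h _ hi
  simpa using this

/-- A hard rectangle (`ℓ ≥ 1`) has a nonempty Alice side (given any coordinate to name). -/
theorem Hard.nonempty_left {A B : Set (ι → Bool)} {ℓ : ℕ} (h : Hard A B ℓ) (hℓ : 1 ≤ ℓ) (i : ι) :
    A.Nonempty := by
  by_contra hA
  rw [Set.not_nonempty_iff_eq_empty] at hA
  have h0 : ℓ = 0 := h.eq_zero_of_leaf (i := i) (by intro a ha; simp [hA] at ha)
  omega

theorem Hard.nonempty_right {A B : Set (ι → Bool)} {ℓ : ℕ} (h : Hard A B ℓ) (hℓ : 1 ≤ ℓ) (i : ι) :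
    B.Nonempty := by
  by_contra hB
  rw [Set.not_nonempty_iff_eq_empty] at hB
  have h0 : ℓ = 0 := h.eq_zero_of_leaf (i := i) (by intro a ha b hb; simp [hB] at hb)
  omega

/-- **One-bit subadditivity, Alice side** [verbatim `LabelPublic.Hard.split_alice`]. -/
theorem Hard.split_alice {A B : Set (ι → Bool)} {ℓ : ℕ} (h : Hard A B ℓ) (hA : A.Nonempty) (i₀ : ι)
    (φ : (ι → Bool) → Bool) :
    ∃ β : Bool, (A ∩ {a | φ a = β}).Nonempty ∧ Hard (A ∩ {a | φ a = β}) B (ℓ - 1) := by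
  classical
  by_cases hℓ : ℓ ≤ 1
  · obtain ⟨a, ha⟩ := hA
    refine ⟨φ a, ⟨a, ha, rfl⟩, ?_⟩
    have : ℓ - 1 = 0 := by omega
    rw [this]
    exact hard_zero _ _
  · have key : ∃ β : Bool, Hard (A ∩ {a | φ a = β}) B (ℓ - 1) := by
      by_contra hcon
      push Not at hcon
      have h0 := hcon false
      have h1 := hcon true
      simp only [Hard, not_forall, not_le] at h0 h1
      obtain ⟨Q0, hQ0, hd0⟩ := h0
      obtain ⟨Q1, hQ1, hd1⟩ := h1
      have hsol : SolvesRect (KWTree.alice φ Q0 Q1) A B := by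
        intro a ha b hb
        by_cases hφ : φ a = true
        · simp only [KWTree.run_alice, hφ, if_true]
          exact hQ1 a ⟨ha, hφ⟩ b hb
        · simp only [KWTree.run_alice, hφ]
          exact hQ0 a ⟨ha, by simpa using hφ⟩ b hb
      have := h _ hsol
      simp only [KWTree.depth_alice] at this
      omega
    obtain ⟨β, hβ⟩ := key
    exact ⟨β, hβ.nonempty_left (by omega) i₀, hβ⟩

/-- **One-bit subadditivity, Bob side** [verbatim `LabelPublic.Hard.split_bob`]. -/
theorem Hard.split_bob {A B : Set (ι → Bool)} {ℓ : ℕ} (h : Hard A B ℓ) (hB : B.Nonempty) (i₀ : ι)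
    (φ : (ι → Bool) → Bool) :
    ∃ β : Bool, (B ∩ {b | φ b = β}).Nonempty ∧ Hard A (B ∩ {b | φ b = β}) (ℓ - 1) := by
  classical
  by_cases hℓ : ℓ ≤ 1
  · obtain ⟨b, hb⟩ := hB
    refine ⟨φ b, ⟨b, hb, rfl⟩, ?_⟩
    have : ℓ - 1 = 0 := by omega
    rw [this]
    exact hard_zero _ _
  · have key : ∃ β : Bool, Hard A (B ∩ {b | φ b = β}) (ℓ - 1) := by
      by_contra hcon
      push Not at hcon
      have h0 := hcon false
      have h1 := hcon true
      simp only [Hard, not_forall, not_le] at h0 h1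
      obtain ⟨Q0, hQ0, hd0⟩ := h0
      obtain ⟨Q1, hQ1, hd1⟩ := h1
      have hsol : SolvesRect (KWTree.bob φ Q0 Q1) A B := by
        intro a ha b hb
        by_cases hφ : φ b = true
        · simp only [KWTree.run_bob, hφ, if_true]
          exact hQ1 a ha b ⟨hb, hφ⟩
        · simp only [KWTree.run_bob, hφ]
          exact hQ0 a ha b ⟨hb, by simpa using hφ⟩
      have := h _ hsol
      simp only [KWTree.depth_bob] at this
      omega
    obtain ⟨β, hβ⟩ := key
    exact ⟨β, hβ.nonempty_right (by omega) i₀, hβ⟩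

/-- Hardness of the role-swapped rectangle [verbatim `LabelPublic.Hard.swap`]. -/
theorem Hard.swap {A B : Set (ι → Bool)} {ℓ : ℕ} (h : Hard A B ℓ) : Hard B A ℓ := by
  intro Q hQ
  have hsol : SolvesRect Q.swap A B := by
    intro a ha b hb
    rw [KWTree.run_swap]
    exact fun h' => hQ b hb a ha h'.symm
  simpa using h _ hsol

end RectLemmas

/-! ### State lemmas: M3's `AE / RA / Alive / cst / rowChild` bookkeeping [verbatim `LabelPublic` §2],
the fibred sets `XSetE`, loads of extended systems, typing, fibred realisation inside `XSetE` -/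
section StateLemmas

variable {m n : ℕ} {g : (Fin n → Bool) → Bool} {q : ℕ}

/-- Parity on a singleton support is the entry. -/
@[simp] theorem parityOn_singleton (p : Fin m × Fin n) (X : Fin m × Fin n → Bool) :
    parityOn {p} X = X p := by
  unfold parityOn
  cases h : X p <;> simp [Finset.filter_singleton, h]

/-- Row loads of an extended system. -/
theorem rowLoad_cons (e : Finset (Fin m × Fin n) × Bool) (E : AffSys m n) (i : Fin m) :
    rowLoad (e :: E) i = rowLoad E i + (if i ∈ eqRows e.1 then 1 else 0) := by
  unfold rowLoad
  rw [List.filter_cons]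
  by_cases h : i ∈ eqRows e.1
  · simp [h]
  · simp [h]

theorem rowLoad_cons_le (e : Finset (Fin m × Fin n) × Bool) (E : AffSys m n) (i : Fin m) :
    rowLoad (e :: E) i ≤ rowLoad E i + 1 := by
  rw [rowLoad_cons]
  split <;> omega

theorem rowLoad_cons_of_not_mem (e : Finset (Fin m × Fin n) × Bool) (E : AffSys m n) {i : Fin m}
    (h : i ∉ eqRows e.1) : rowLoad (e :: E) i = rowLoad E i := by
  rw [rowLoad_cons, if_neg h, Nat.add_zero]

theorem rowLoad_nil (i : Fin m) : rowLoad ([] : AffSys m n) i = 0 := rfl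

theorem mem_eqRows_singleton {p : Fin m × Fin n} {i : Fin m} :
    i ∈ eqRows ({p} : Finset (Fin m × Fin n)) ↔ i = p.1 := by
  simp [eqRows]

theorem cst_le_one (E : Set (Fin m → Bool)) (i : Fin m) : cst E i ≤ 1 := by
  unfold cst; split <;> simp

theorem cst_mono {E E' : Set (Fin m → Bool)} (h : E' ⊆ E) (i : Fin m) : cst E i ≤ cst E' i := by
  classical
  unfold cst
  by_cases hE : ∃ v, ∀ a ∈ E, a i = v
  · obtain ⟨v, hv⟩ := hE
    have hE' : ∃ v, ∀ a ∈ E', a i = v := ⟨v, fun a ha => hv a (h ha)⟩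
    rw [if_pos ⟨v, hv⟩, if_pos hE']
  · rw [if_neg hE]; exact Nat.zero_le _

theorem cst_eq_one {E : Set (Fin m → Bool)} {i : Fin m} {v : Bool} (h : ∀ a ∈ E, a i = v) :
    cst E i = 1 := by
  classical
  unfold cst; rw [if_pos ⟨v, h⟩]

theorem cst_eq_zero {E : Set (Fin m → Bool)} {i : Fin m} {a a' : Fin m → Bool} (ha : a ∈ E)
    (ha' : a' ∈ E) (h : a i ≠ a' i) : cst E i = 0 := by
  classical
  unfold cst
  rw [if_neg]
  rintro ⟨v, hv⟩
  exact h ((hv a ha).trans (hv a' ha').symm)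

theorem AE_subset {A : Set (Fin m → Bool)} {S : Fin m → Set (Fin n → Bool)} : AE g A S ⊆ A :=
  fun _ ha => ha.1

theorem Alive.mono {A A' B B' : Set (Fin m → Bool)} {S S' T T' : Fin m → Set (Fin n → Bool)}
    {i : Fin m} {α : Bool} (h : Alive g A' B' S' T' i α) (hA : AE g A' S' ⊆ AE g A S)
    (hB : AE g B' T' ⊆ AE g B T) : Alive g A B S T i α :=
  ⟨h.1.imp fun _ ⟨ha, hai⟩ => ⟨hA ha, hai⟩, h.2.imp fun _ ⟨hb, hbi⟩ => ⟨hB hb, hbi⟩⟩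

/-- Label test: intersect the label set. -/
theorem AE_inter_label (A : Set (Fin m → Bool)) (S : Fin m → Set (Fin n → Bool))
    (φ : (Fin m → Bool) → Bool) (β : Bool) :
    AE g (A ∩ {a | φ a = β}) S = AE g A S ∩ {a | φ a = β} := by
  ext a; simp only [AE, Set.mem_setOf_eq, Set.mem_inter_iff]; tauto

theorem XSetE_inter_label (A : Set (Fin m → Bool)) (S : Fin m → Set (Fin n → Bool)) (E : AffSys m n)
    (φ : (Fin m → Bool) → Bool) (β : Bool) :
    XSetE g (A ∩ {a | φ a = β}) S E = XSetE g A S E ∩ {X | φ (rowLabels g X) = β} := by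
  ext X; simp only [XSetE, Set.mem_setOf_eq, Set.mem_inter_iff]; tauto

/-- Row test on row `i` with bit `ψ`, answer `β`: shrink `S i` [verbatim `LabelPublic.rowChild`]. -/
def rowChild (S : Fin m → Set (Fin n → Bool)) (i : Fin m) (ψ : (Fin n → Bool) → Bool) (β : Bool) :
    Fin m → Set (Fin n → Bool) :=
  Function.update S i (S i ∩ {x | ψ x = β})

theorem rowChild_self (S : Fin m → Set (Fin n → Bool)) (i : Fin m) (ψ : (Fin n → Bool) → Bool)
    (β : Bool) : rowChild S i ψ β i = S i ∩ {x | ψ x = β} := by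
  simp [rowChild]

theorem rowChild_of_ne (S : Fin m → Set (Fin n → Bool)) {i i' : Fin m} (ψ : (Fin n → Bool) → Bool)
    (β : Bool) (h : i' ≠ i) : rowChild S i ψ β i' = S i' := by
  simp [rowChild, h]

theorem rowChild_subset (S : Fin m → Set (Fin n → Bool)) (i : Fin m) (ψ : (Fin n → Bool) → Bool)
    (β : Bool) (i' : Fin m) : rowChild S i ψ β i' ⊆ S i' := by
  by_cases h : i' = i
  · subst h; rw [rowChild_self]; exact Set.inter_subset_left
  · rw [rowChild_of_ne _ _ _ h]

theorem XSetE_rowChild (A : Set (Fin m → Bool)) (S : Fin m → Set (Fin n → Bool)) (E : AffSys m n)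
    (i : Fin m) (ψ : (Fin n → Bool) → Bool) (β : Bool) :
    XSetE g A (rowChild S i ψ β) E = XSetE g A S E ∩ {X | ψ (row X i) = β} := by
  ext X
  simp only [XSetE, Set.mem_setOf_eq, Set.mem_inter_iff]
  constructor
  · rintro ⟨hA, hS, hE⟩
    have hi := hS i
    rw [rowChild_self] at hi
    exact ⟨⟨hA, fun i' => rowChild_subset S i ψ β i' (hS i'), hE⟩, hi.2⟩
  · rintro ⟨⟨hA, hS, hE⟩, hψ⟩
    refine ⟨hA, fun i' => ?_, hE⟩
    by_cases h : i' = i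
    · subst h; rw [rowChild_self]; exact ⟨hS i', hψ⟩
    · rw [rowChild_of_ne _ _ _ h]; exact hS i'

/-- The part of the row game of `(i, α)` surviving the answer `β`. -/
theorem RA_rowChild_self (S : Fin m → Set (Fin n → Bool)) (i : Fin m) (ψ : (Fin n → Bool) → Bool)
    (β α : Bool) : RA g (rowChild S i ψ β) i α = RA g S i α ∩ {x | ψ x = β} := by
  ext x; simp only [RA, rowChild_self, Set.mem_inter_iff, Set.mem_setOf_eq]; tauto

theorem RA_rowChild_of_ne (S : Fin m → Set (Fin n → Bool)) {i i' : Fin m} (ψ : (Fin n → Bool) → Bool)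
    (β α : Bool) (h : i' ≠ i) : RA g (rowChild S i ψ β) i' α = RA g S i' α := by
  simp only [RA, rowChild_of_ne _ _ _ h]

theorem AE_rowChild_subset (A : Set (Fin m → Bool)) (S : Fin m → Set (Fin n → Bool)) (i : Fin m)
    (ψ : (Fin n → Bool) → Bool) (β : Bool) : AE g A (rowChild S i ψ β) ⊆ AE g A S := by
  rintro a ⟨haA, hreal⟩
  exact ⟨haA, fun i' => (hreal i').imp fun x ⟨hx, hgx⟩ => ⟨rowChild_subset S i ψ β i' hx, hgx⟩⟩

/-- A realisable column stays realisable after the row answer iff its own part of row `i` survives. -/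
theorem mem_AE_rowChild {A : Set (Fin m → Bool)} {S : Fin m → Set (Fin n → Bool)} {i : Fin m}
    {ψ : (Fin n → Bool) → Bool} {β : Bool} {a : Fin m → Bool} (ha : a ∈ AE g A S)
    (hpart : (RA g S i (a i) ∩ {x | ψ x = β}).Nonempty) : a ∈ AE g A (rowChild S i ψ β) := by
  refine ⟨ha.1, fun i' => ?_⟩
  by_cases h : i' = i
  · subst h
    obtain ⟨x, ⟨hxS, hgx⟩, hψ⟩ := hpart
    exact ⟨x, by rw [rowChild_self]; exact ⟨hxS, hψ⟩, hgx⟩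
  · rw [rowChild_of_ne _ _ _ h]; exact ha.2 i'

/-- Adding an equation to the common system cuts the fibred set by that equation. -/
theorem XSetE_cons (A : Set (Fin m → Bool)) (S : Fin m → Set (Fin n → Bool)) (E : AffSys m n)
    (e : Finset (Fin m × Fin n) × Bool) :
    XSetE g A S (e :: E) = XSetE g A S E ∩ {X | parityOn e.1 X = e.2} := by
  ext X
  simp only [XSetE, Sat, Set.mem_setOf_eq, Set.mem_inter_iff, List.forall_mem_cons]
  tauto

/-- The realisable label columns at the root: all of `A` (when `g` takes both values). -/
theorem AE_root (hg : ∀ α : Bool, ∃ x, g x = α) (A : Set (Fin m → Bool)) :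
    AE g A (fun _ => Set.univ) = A := by
  ext a
  simp only [AE, Set.mem_setOf_eq, Set.mem_univ, true_and]
  exact ⟨fun h => h.1, fun h => ⟨h, fun i => hg (a i)⟩⟩

/-- Typing discipline ⟹ every row is equation-free or row-set-free (Alice side). -/
theorem StateOK.typed_left {τ : Fin m → RowType} {S T : Fin m → Set (Fin n → Bool)} {E : AffSys m n}
    (h : StateOK τ S T E) (i : Fin m) : rowLoad E i = 0 ∨ S i = Set.univ := by
  by_cases hτ : τ i = RowType.algebraic
  · exact Or.inr ((h i).2 (by rw [hτ]; exact fun h' => RowType.noConfusion h')).1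
  · exact Or.inl ((h i).1 hτ)

/-- Typing discipline ⟹ every row is equation-free or row-set-free (Bob side). -/
theorem StateOK.typed_right {τ : Fin m → RowType} {S T : Fin m → Set (Fin n → Bool)} {E : AffSys m n}
    (h : StateOK τ S T E) (i : Fin m) : rowLoad E i = 0 ∨ T i = Set.univ := by
  by_cases hτ : τ i = RowType.algebraic
  · exact Or.inr ((h i).2 (by rw [hτ]; exact fun h' => RowType.noConfusion h')).2
  · exact Or.inl ((h i).1 hτ)

/-- The typing below a single-row test on a non-algebraic row `i` (Alice's row-set shrinks). -/
theorem StateOK.rowChild_left {τ : Fin m → RowType} {S T : Fin m → Set (Fin n → Bool)}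
    {E : AffSys m n} (h : StateOK τ S T E) {i : Fin m} (hτi : τ i ≠ RowType.algebraic)
    (ψ : (Fin n → Bool) → Bool) (β : Bool) :
    StateOK (Function.update τ i RowType.combinatorial) (rowChild S i ψ β) T E := by
  intro i'
  by_cases hi : i' = i
  · subst hi
    rw [Function.update_self]
    exact ⟨fun _ => (h i').1 hτi, fun h' => (h' rfl).elim⟩
  · rw [Function.update_of_ne hi, rowChild_of_ne _ _ _ hi]
    exact h i'

/-- The typing below a single-row test on a non-algebraic row `i` (Bob's row-set shrinks). -/
theorem StateOK.rowChild_right {τ : Fin m → RowType} {S T : Fin m → Set (Fin n → Bool)}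
    {E : AffSys m n} (h : StateOK τ S T E) {i : Fin m} (hτi : τ i ≠ RowType.algebraic)
    (ψ : (Fin n → Bool) → Bool) (β : Bool) :
    StateOK (Function.update τ i RowType.combinatorial) S (rowChild T i ψ β) E := by
  intro i'
  by_cases hi : i' = i
  · subst hi
    rw [Function.update_self]
    exact ⟨fun _ => (h i').1 hτi, fun h' => (h' rfl).elim⟩
  · rw [Function.update_of_ne hi, rowChild_of_ne _ _ _ hi]
    exact h i'

/-- The typing below an affine test avoiding combinatorial rows, its equation added to `E`. -/
theorem StateOK.retag_cons {τ : Fin m → RowType} {S T : Fin m → Set (Fin n → Bool)} {E : AffSys m n}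
    (h : StateOK τ S T E) {S₀ : Finset (Fin m × Fin n)}
    (hτ : ∀ i ∈ touchedRows S₀, τ i ≠ RowType.combinatorial) (b : Bool) :
    StateOK (retag S₀ τ) S T ((S₀, b) :: E) := by
  intro i
  by_cases hmem : i ∈ touchedRows S₀
  · have hτi : retag S₀ τ i = RowType.algebraic := by simp [retag, hmem]
    rw [hτi]
    exact ⟨fun h' => (h' rfl).elim, fun _ => (h i).2 (hτ i hmem)⟩
  · have hτi : retag S₀ τ i = τ i := by simp [retag, hmem]
    rw [hτi, rowLoad_cons_of_not_mem _ _ hmem]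
    exact h i

/-- The pin equation `X_p = b` keeps the typing when row `p.1` is algebraic. -/
theorem StateOK.pin_cons {τ : Fin m → RowType} {S T : Fin m → Set (Fin n → Bool)} {E : AffSys m n}
    (h : StateOK τ S T E) {p : Fin m × Fin n} (hp : τ p.1 = RowType.algebraic) (b : Bool) :
    StateOK τ S T (({p}, b) :: E) := by
  intro i
  by_cases hi : i = p.1
  · rw [hi, hp]
    exact ⟨fun h' => (h' rfl).elim, fun _ => (h p.1).2 (by rw [hp]; exact fun h' => RowType.noConfusion h')⟩
  · rw [rowLoad_cons_of_not_mem _ _ (by rw [mem_eqRows_singleton]; exact hi)]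
    exact h i

/-- **Fibred realisation** (S2 inside the state): a realisable label column is carried by a matrix of
the fibred set. -/
theorem exists_XE (hLU : PerRowLU g m q) {E : AffSys m n} (hload : ∀ i, rowLoad E i ≤ q)
    (hsat : ∃ X, Sat E X) {S : Fin m → Set (Fin n → Bool)} (htyped : ∀ i, rowLoad E i = 0 ∨ S i = Set.univ)
    {A : Set (Fin m → Bool)} {a : Fin m → Bool} (ha : a ∈ AE g A S) :
    ∃ X ∈ XSetE g A S E, rowLabels g X = a := by
  obtain ⟨X, hX, hlab, hrows⟩ := exists_X_fibred' hLU hload hsat S htyped ha.2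
  exact ⟨X, ⟨by rw [hlab]; exact ha.1, hrows, hX⟩, hlab⟩

/-- Fibred realisation with a prescribed equation-free row. -/
theorem exists_XE_row (hLU : PerRowLU g m q) {E : AffSys m n} (hload : ∀ i, rowLoad E i ≤ q)
    (hsat : ∃ X, Sat E X) {S : Fin m → Set (Fin n → Bool)} (htyped : ∀ i, rowLoad E i = 0 ∨ S i = Set.univ)
    {A : Set (Fin m → Bool)} {a : Fin m → Bool} (ha : a ∈ AE g A S) {i : Fin m} (hi : rowLoad E i = 0)
    {x : Fin n → Bool} (hx : x ∈ S i) (hgx : g x = a i) :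
    ∃ X ∈ XSetE g A S E, rowLabels g X = a ∧ row X i = x := by
  obtain ⟨X, hX, hlab, hrows, hrow⟩ := exists_X_fibred hLU hload hsat S htyped ha.2 hi hx hgx
  exact ⟨X, ⟨by rw [hlab]; exact ha.1, hrows, hX⟩, hlab, hrow⟩

variable (g) in
/-- **The glued invariant** at typing `τ` for a subtree `P`: for every fibred state compatible with `τ`
on which `P` is correct — common system `E` satisfiable with `rowLoad E i + k ≤ q`, realisable label
rectangle `ℓ`-hard, alive row games `r`-hard with `K ≤ r + #constant sides` — `ℓ + min K k ≤ depth + 2`. -/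
def InvAt (q : ℕ) (τ : Fin m → RowType) (P : KWTree (Fin m × Fin n)) : Prop :=
  ∀ (A B : Set (Fin m → Bool)) (S T : Fin m → Set (Fin n → Bool)) (E : AffSys m n) (k : ℕ),
    StateOK τ S T E → (∃ X, Sat E X) → (∀ i, rowLoad E i + k ≤ q) →
    ValidOnE g P A B S T E → (∀ a ∈ AE g A S, ∀ b ∈ AE g B T, a ≠ b) →
    (AE g A S).Nonempty → (AE g B T).Nonempty →
    ∀ (ℓ K : ℕ) (r : Fin m → Bool → ℕ), Hard (AE g A S) (AE g B T) ℓ →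
      (∀ i α, Alive g A B S T i α → Hard (RA g S i α) (RA g T i (!α)) (r i α)) →
      (∀ i α, Alive g A B S T i α → K ≤ r i α + cst (AE g A S) i + cst (AE g B T) i) →
      ℓ + min K k ≤ P.depth + 2

end StateLemmas

/-! ### The steps of the glued adversary -/
section Steps

variable {m n : ℕ} {g : (Fin n → Bool) → Bool} {q : ℕ}

/-- **Private collapse** (`k = 0`, and in fact at any time): label-exact PRIVATE families of fibred
matrices (S2) turn the subtree into a protocol of the same depth for the realisable label rectangle
(violation = equal labels in the output row), so `ℓ ≤ depth`. -/
theorem collapseE (hLU : PerRowLU g m q) {τ : Fin m → RowType} {A B : Set (Fin m → Bool)}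
    {S T : Fin m → Set (Fin n → Bool)} {E : AffSys m n} (hst : StateOK τ S T E) (hsat : ∃ X, Sat E X)
    (hload : ∀ i, rowLoad E i ≤ q) {P : KWTree (Fin m × Fin n)} (hV : ValidOnE g P A B S T E)
    {ℓ : ℕ} (hH : Hard (AE g A S) (AE g B T) ℓ) : ℓ ≤ P.depth := by
  classical
  have hA : ∀ a, a ∈ AE g A S → ∃ X ∈ XSetE g A S E, rowLabels g X = a :=
    fun a ha => exists_XE hLU hload hsat hst.typed_left ha
  have hB : ∀ b, b ∈ AE g B T → ∃ Y ∈ XSetE g B T E, rowLabels g Y = b :=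
    fun b hb => exists_XE hLU hload hsat hst.typed_right hb
  let FA : (Fin m → Bool) → (Fin m × Fin n → Bool) := fun a =>
    if h : a ∈ AE g A S then (hA a h).choose else fun _ => false
  let FB : (Fin m → Bool) → (Fin m × Fin n → Bool) := fun b =>
    if h : b ∈ AE g B T then (hB b h).choose else fun _ => false
  have hFA : ∀ a, a ∈ AE g A S → FA a ∈ XSetE g A S E ∧ rowLabels g (FA a) = a := by
    intro a h
    have := (hA a h).choose_spec
    simp only [FA, dif_pos h]
    exact this
  have hFB : ∀ b, b ∈ AE g B T → FB b ∈ XSetE g B T E ∧ rowLabels g (FB b) = b := by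
    intro b h
    have := (hB b h).choose_spec
    simp only [FB, dif_pos h]
    exact this
  have hsol : SolvesRect (P.comap FA FB Prod.fst) (AE g A S) (AE g B T) := by
    intro a ha b hb
    rw [KWTree.run_comap]
    obtain ⟨hXa, hla⟩ := hFA a ha
    obtain ⟨hYb, hlb⟩ := hFB b hb
    have h2 := (hV _ hXa _ hYb).2
    rw [hla, hlb] at h2
    exact h2
  have := hH _ hsol
  rwa [KWTree.depth_comap] at this

/-- **LEAF** `(i, j)`.  Labels differ at `i` on the realisable rectangle, so `ℓ = 0`.  If row `i` carries
no equation, M3's argument: the row game of the output orientation is solved by the leaf `j` (fibred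
realisation with row `i` prescribed), so `K ≤ 2`.  If row `i` carries equations (so both row-sets are
`univ`) and `k ≥ 1`, the pin `X_{ij} = c` joins `E` and a valid pair with equal `(i, j)` entries exists:
contradiction.  With `k = 0` the bound is `0 ≤ 2`. -/
theorem inv_leafAt (hLU : PerRowLU g m q) (p : Fin m × Fin n) (τ : Fin m → RowType) :
    InvAt g q τ (KWTree.leaf p) := by
  classical
  intro A B S T E k hst hsat hload hV hD hneA hneB ℓ K r hL hR hK
  obtain ⟨i, j⟩ := p
  obtain ⟨a, ha⟩ := hneA
  obtain ⟨b, hb⟩ := hneB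
  have hloadq : ∀ i, rowLoad E i ≤ q := fun i => by have := hload i; omega
  have htS := hst.typed_left
  have htT := hst.typed_right
  -- labels differ at `i` on the whole realisable rectangle
  have hdiff : ∀ a ∈ AE g A S, ∀ b ∈ AE g B T, a i ≠ b i := by
    intro a ha b hb
    obtain ⟨X, hX, hXa⟩ := exists_XE hLU hloadq hsat htS ha
    obtain ⟨Y, hY, hYb⟩ := exists_XE hLU hloadq hsat htT hb
    have h2 := (hV X hX Y hY).2
    simp only [KWTree.run_leaf] at h2
    rw [hXa, hYb] at h2
    exact h2
  have hℓ : ℓ = 0 := hL.eq_zero_of_leaf (i := i) (fun a ha b hb => by simpa using hdiff a ha b hb)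
  cases k with
  | zero => simp [hℓ]
  | succ k =>
    by_cases hEi : rowLoad E i = 0
    · -- M3 leaf: the row game of the output orientation is solved by the leaf `j`
      have hab : b i = !(a i) := by
        have := hdiff a ha b hb
        cases hai : a i <;> cases hbi : b i <;> simp_all
      have halive : Alive g A B S T i (a i) := ⟨⟨a, ha, rfl⟩, ⟨b, hb, hab⟩⟩
      have hr : r i (a i) = 0 := by
        refine (hR i (a i) halive).eq_zero_of_leaf (i := j) ?_
        intro x hx y hy
        obtain ⟨X, hX, -, hXi⟩ := exists_XE_row hLU hloadq hsat htS ha hEi hx.1 hx.2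
        obtain ⟨Y, hY, -, hYi⟩ := exists_XE_row hLU hloadq hsat htT hb hEi hy.1 (hy.2.trans hab.symm)
        have h1 := (hV X hX Y hY).1
        simp only [KWTree.run_leaf] at h1
        have hx' : X (i, j) = x j := by rw [← hXi]; rfl
        have hy' : Y (i, j) = y j := by rw [← hYi]; rfl
        simpa [hx', hy'] using h1
      have hk := hK i (a i) halive
      have h1 := cst_le_one (AE g A S) i
      have h2 := cst_le_one (AE g B T) i
      simp only [KWTree.depth_leaf]
      omega
    · -- algebraic leaf: pin the entry `(i, j)` for both players
      exfalso
      have hτi : τ i = RowType.algebraic := by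
        by_contra hne
        exact hEi ((hst i).1 hne)
      obtain ⟨X₀, hX₀⟩ := hsat
      set E' : AffSys m n := (({(i, j)}, X₀ (i, j)) :: E) with hE'
      have hst' : StateOK τ S T E' := hst.pin_cons (p := (i, j)) hτi (X₀ (i, j))
      have hsat' : ∃ X, Sat E' X := ⟨X₀, fun e he => by
        rcases List.mem_cons.1 he with rfl | he
        · simp
        · exact hX₀ e he⟩
      have hload' : ∀ i', rowLoad E' i' ≤ q := fun i' => by
        have h1 := rowLoad_cons_le ({(i, j)}, X₀ (i, j)) E i'
        have h2 := hload i'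
        rw [hE']
        omega
      obtain ⟨X, hX, -⟩ := exists_XE hLU hload' hsat' hst'.typed_left ha
      obtain ⟨Y, hY, -⟩ := exists_XE hLU hload' hsat' hst'.typed_right hb
      rw [hE', XSetE_cons] at hX hY
      have hXp : X (i, j) = X₀ (i, j) := by simpa using hX.2
      have hYp : Y (i, j) = X₀ (i, j) := by simpa using hY.2
      have h1 := (hV X hX.1 Y hY.1).1
      simp only [KWTree.run_leaf] at h1
      exact h1 (hXp.trans hYp.symm)

/-- Which subtree the play enters on the bit `β`, with its invariant and depth bound (Alice node). -/
theorem alice_childAt {τ : Fin m → RowType} {s : (Fin m × Fin n → Bool) → Bool}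
    {P Q : KWTree (Fin m × Fin n)} (hIP : InvAt g q τ P) (hIQ : InvAt g q τ Q) (β : Bool) :
    ∃ C : KWTree (Fin m × Fin n), InvAt g q τ C ∧ C.depth ≤ max P.depth Q.depth ∧
      ∀ X Y, s X = β → (KWTree.alice s P Q).run X Y = C.run X Y := by
  cases β
  · exact ⟨P, hIP, le_max_left _ _, fun X Y h => by simp [h]⟩
  · exact ⟨Q, hIQ, le_max_right _ _, fun X Y h => by simp [h]⟩

/-- Which subtree the play enters on the bit `β` (Bob node). -/
theorem bob_childAt {τ : Fin m → RowType} {s : (Fin m × Fin n → Bool) → Bool}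
    {P Q : KWTree (Fin m × Fin n)} (hIP : InvAt g q τ P) (hIQ : InvAt g q τ Q) (β : Bool) :
    ∃ C : KWTree (Fin m × Fin n), InvAt g q τ C ∧ C.depth ≤ max P.depth Q.depth ∧
      ∀ X Y, s Y = β → (KWTree.bob s P Q).run X Y = C.run X Y := by
  cases β
  · exact ⟨P, hIP, le_max_left _ _, fun X Y h => by simp [h]⟩
  · exact ⟨Q, hIQ, le_max_right _ _, fun X Y h => by simp [h]⟩

/-- ALICE LABEL TEST: `ℓ` drops by at most one (subadditivity); everything else is kept. -/
theorem label_stepAt_alice (i₀ : Fin m) {τ : Fin m → RowType} {s : (Fin m × Fin n → Bool) → Bool}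
    {P Q : KWTree (Fin m × Fin n)} {φ : (Fin m → Bool) → Bool} (hφ : ∀ X, s X = φ (rowLabels g X))
    (hIP : InvAt g q τ P) (hIQ : InvAt g q τ Q) : InvAt g q τ (KWTree.alice s P Q) := by
  intro A B S T E k hst hsat hload hV hD hneA hneB ℓ K r hL hR hK
  obtain ⟨β, hne, hH⟩ := hL.split_alice hneA i₀ φ
  obtain ⟨C, hIC, hCd, hrun⟩ := alice_childAt (s := s) hIP hIQ β
  set A' : Set (Fin m → Bool) := A ∩ {a | φ a = β} with hA'
  have hAE : AE g A' S = AE g A S ∩ {a | φ a = β} := AE_inter_label A S φ β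
  have hsub : AE g A' S ⊆ AE g A S := by rw [hAE]; exact Set.inter_subset_left
  have hV' : ValidOnE g C A' B S T E := by
    intro X hX Y hY
    rw [hA', XSetE_inter_label] at hX
    have hsX : s X = β := by rw [hφ X]; exact hX.2
    have := hV X hX.1 Y hY
    rwa [hrun X Y hsX] at this
  have hD' : ∀ a ∈ AE g A' S, ∀ b ∈ AE g B T, a ≠ b := fun a ha b hb => hD a (hsub ha) b hb
  have hneA' : (AE g A' S).Nonempty := by rw [hAE]; exact hne
  have hL' : Hard (AE g A' S) (AE g B T) (ℓ - 1) := by rw [hAE]; exact hH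
  have hR' : ∀ i α, Alive g A' B S T i α → Hard (RA g S i α) (RA g T i (!α)) (r i α) :=
    fun i α h => hR i α (h.mono hsub fun _ hb => hb)
  have hK' : ∀ i α, Alive g A' B S T i α → K ≤ r i α + cst (AE g A' S) i + cst (AE g B T) i := by
    intro i α h
    have hk := hK i α (h.mono hsub fun _ hb => hb)
    have hc := cst_mono hsub i
    omega
  have := hIC A' B S T E k hst hsat hload hV' hD' hneA' hneB (ℓ - 1) K r hL' hR' hK'
  simp only [KWTree.depth_alice]
  omega

/-- BOB LABEL TEST. -/
theorem label_stepAt_bob (i₀ : Fin m) {τ : Fin m → RowType} {s : (Fin m × Fin n → Bool) → Bool}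
    {P Q : KWTree (Fin m × Fin n)} {φ : (Fin m → Bool) → Bool} (hφ : ∀ Y, s Y = φ (rowLabels g Y))
    (hIP : InvAt g q τ P) (hIQ : InvAt g q τ Q) : InvAt g q τ (KWTree.bob s P Q) := by
  intro A B S T E k hst hsat hload hV hD hneA hneB ℓ K r hL hR hK
  obtain ⟨β, hne, hH⟩ := hL.split_bob hneB i₀ φ
  obtain ⟨C, hIC, hCd, hrun⟩ := bob_childAt (s := s) hIP hIQ β
  set B' : Set (Fin m → Bool) := B ∩ {b | φ b = β} with hB'
  have hAE : AE g B' T = AE g B T ∩ {b | φ b = β} := AE_inter_label B T φ β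
  have hsub : AE g B' T ⊆ AE g B T := by rw [hAE]; exact Set.inter_subset_left
  have hV' : ValidOnE g C A B' S T E := by
    intro X hX Y hY
    rw [hB', XSetE_inter_label] at hY
    have hsY : s Y = β := by rw [hφ Y]; exact hY.2
    have := hV X hX Y hY.1
    rwa [hrun X Y hsY] at this
  have hD' : ∀ a ∈ AE g A S, ∀ b ∈ AE g B' T, a ≠ b := fun a ha b hb => hD a ha b (hsub hb)
  have hneB' : (AE g B' T).Nonempty := by rw [hAE]; exact hne
  have hL' : Hard (AE g A S) (AE g B' T) (ℓ - 1) := by rw [hAE]; exact hH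
  have hR' : ∀ i α, Alive g A B' S T i α → Hard (RA g S i α) (RA g T i (!α)) (r i α) :=
    fun i α h => hR i α (h.mono (fun _ ha => ha) hsub)
  have hK' : ∀ i α, Alive g A B' S T i α → K ≤ r i α + cst (AE g A S) i + cst (AE g B' T) i := by
    intro i α h
    have hk := hK i α (h.mono (fun _ ha => ha) hsub)
    have hc := cst_mono hsub i
    omega
  have := hIC A B' S T E k hst hsat hload hV' hD' hneA hneB' (ℓ - 1) K r hL' hR' hK'
  simp only [KWTree.depth_bob]
  omega

/-- ALICE AFFINE TEST on non-combinatorial rows: with budget `k ≥ 1` the `E`-consistent answer joins the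
COMMON system for both players (`k − 1`; label sets, row sets, `AE`, `Alive`, `cst` all unchanged); with
`k = 0` the adversary collapses (`collapseE`). -/
theorem affine_stepAt_alice (hLU : PerRowLU g m q) {τ : Fin m → RowType}
    {s : (Fin m × Fin n → Bool) → Bool} {P Q : KWTree (Fin m × Fin n)} {S₀ : Finset (Fin m × Fin n)}
    {c : Bool} (hs : ∀ X, s X = Bool.xor c (parityOn S₀ X))
    (hτ : ∀ i ∈ touchedRows S₀, τ i ≠ RowType.combinatorial)
    (hIP : InvAt g q (retag S₀ τ) P) (hIQ : InvAt g q (retag S₀ τ) Q) :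
    InvAt g q τ (KWTree.alice s P Q) := by
  intro A B S T E k hst hsat hload hV hD hneA hneB ℓ K r hL hR hK
  cases k with
  | zero =>
    have h := collapseE hLU hst hsat (fun i => by have := hload i; omega) hV hL
    simp only [Nat.min_zero, Nat.add_zero]
    omega
  | succ k =>
    obtain ⟨X₀, hX₀⟩ := hsat
    obtain ⟨C, hIC, hCd, hrun⟩ := alice_childAt (s := s) hIP hIQ (Bool.xor c (parityOn S₀ X₀))
    set E' : AffSys m n := (S₀, parityOn S₀ X₀) :: E with hE'
    have hst' : StateOK (retag S₀ τ) S T E' := hst.retag_cons hτ (parityOn S₀ X₀)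
    have hsat' : ∃ X, Sat E' X := ⟨X₀, fun e he => by
      rcases List.mem_cons.1 he with rfl | he
      · rfl
      · exact hX₀ e he⟩
    have hload' : ∀ i, rowLoad E' i + k ≤ q := fun i => by
      have h1 := rowLoad_cons_le (S₀, parityOn S₀ X₀) E i
      have h2 := hload i
      rw [hE']
      omega
    have hV' : ValidOnE g C A B S T E' := by
      intro X hX Y hY
      rw [hE', XSetE_cons] at hX hY
      have h2 : parityOn S₀ X = parityOn S₀ X₀ := hX.2
      have hsX : s X = Bool.xor c (parityOn S₀ X₀) := by rw [hs X, h2]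
      have := hV X hX.1 Y hY.1
      rwa [hrun X Y hsX] at this
    have := hIC A B S T E' k hst' hsat' hload' hV' hD hneA hneB ℓ K r hL hR hK
    simp only [KWTree.depth_alice]
    omega

/-- BOB AFFINE TEST (the equation is read off Bob's side and imposed on both players alike). -/
theorem affine_stepAt_bob (hLU : PerRowLU g m q) {τ : Fin m → RowType}
    {s : (Fin m × Fin n → Bool) → Bool} {P Q : KWTree (Fin m × Fin n)} {S₀ : Finset (Fin m × Fin n)}
    {c : Bool} (hs : ∀ Y, s Y = Bool.xor c (parityOn S₀ Y))
    (hτ : ∀ i ∈ touchedRows S₀, τ i ≠ RowType.combinatorial)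
    (hIP : InvAt g q (retag S₀ τ) P) (hIQ : InvAt g q (retag S₀ τ) Q) :
    InvAt g q τ (KWTree.bob s P Q) := by
  intro A B S T E k hst hsat hload hV hD hneA hneB ℓ K r hL hR hK
  cases k with
  | zero =>
    have h := collapseE hLU hst hsat (fun i => by have := hload i; omega) hV hL
    simp only [Nat.min_zero, Nat.add_zero]
    omega
  | succ k =>
    obtain ⟨X₀, hX₀⟩ := hsat
    obtain ⟨C, hIC, hCd, hrun⟩ := bob_childAt (s := s) hIP hIQ (Bool.xor c (parityOn S₀ X₀))
    set E' : AffSys m n := (S₀, parityOn S₀ X₀) :: E with hE'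
    have hst' : StateOK (retag S₀ τ) S T E' := hst.retag_cons hτ (parityOn S₀ X₀)
    have hsat' : ∃ X, Sat E' X := ⟨X₀, fun e he => by
      rcases List.mem_cons.1 he with rfl | he
      · rfl
      · exact hX₀ e he⟩
    have hload' : ∀ i, rowLoad E' i + k ≤ q := fun i => by
      have h1 := rowLoad_cons_le (S₀, parityOn S₀ X₀) E i
      have h2 := hload i
      rw [hE']
      omega
    have hV' : ValidOnE g C A B S T E' := by
      intro X hX Y hY
      rw [hE', XSetE_cons] at hX hY
      have h2 : parityOn S₀ Y = parityOn S₀ X₀ := hY.2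
      have hsY : s Y = Bool.xor c (parityOn S₀ X₀) := by rw [hs Y, h2]
      have := hV X hX.1 Y hY.1
      rwa [hrun X Y hsY] at this
    have := hIC A B S T E' k hst' hsat' hload' hV' hD hneA hneB ℓ K r hL hR hK
    simp only [KWTree.depth_bob]
    omega

/-- ALICE SINGLE-ROW TEST on a non-algebraic row `i` [M3's `row_step_alice` on the row-set factor]: either
one answer keeps every realisable orientation of row `i` undamaged (then only `K` drops by one), or the
adversary fixes Alice's label `a_i` (costing `ℓ` at most one) and follows an answer undamaged for the
surviving orientation, whose constant-side count goes up by one.  `E`, `k` are untouched. -/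
theorem row_stepAt_alice (i₀ : Fin m) (j₀ : Fin n) {τ : Fin m → RowType}
    {s : (Fin m × Fin n → Bool) → Bool} {P Q : KWTree (Fin m × Fin n)} {i : Fin m}
    {ψ : (Fin n → Bool) → Bool} (hψ : ∀ X, s X = ψ (row X i)) (hτi : τ i ≠ RowType.algebraic)
    (hIP : InvAt g q (Function.update τ i RowType.combinatorial) P)
    (hIQ : InvAt g q (Function.update τ i RowType.combinatorial) Q) :
    InvAt g q τ (KWTree.alice s P Q) := by
  classical
  intro A B S T E k hst hsat hload hV hD hneA hneB ℓ K r hL hR hK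
  -- `Good β α`: after the answer `β` the Alice part of the row game `(i, α)` is nonempty and (if the
  -- orientation is alive) still needs depth `r i α - 1`.
  let Good : Bool → Bool → Prop := fun β α =>
    (RA g S i α ∩ {x | ψ x = β}).Nonempty ∧
      (Alive g A B S T i α → Hard (RA g S i α ∩ {x | ψ x = β}) (RA g T i (!α)) (r i α - 1))
  have G : ∀ α, (∃ a ∈ AE g A S, a i = α) → ∃ β, Good β α := by
    rintro α ⟨a, ha, hai⟩
    obtain ⟨x, hx, hgx⟩ := ha.2 i
    have hxα : x ∈ RA g S i α := ⟨hx, by rw [Set.mem_setOf_eq, hgx, hai]⟩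
    by_cases hal : Alive g A B S T i α
    · obtain ⟨β, hβne, hβH⟩ := (hR i α hal).split_alice ⟨x, hxα⟩ j₀ ψ
      exact ⟨β, hβne, fun _ => hβH⟩
    · exact ⟨ψ x, ⟨x, hxα, rfl⟩, fun h => (hal h).elim⟩
  by_cases hA : ∃ β, ∀ α, (∃ a ∈ AE g A S, a i = α) → Good β α
  · -- CASE A
    obtain ⟨β, hgood⟩ := hA
    obtain ⟨C, hIC, hCd, hrun⟩ := alice_childAt (s := s) hIP hIQ β
    set S' := rowChild S i ψ β with hS'
    have hst' : StateOK (Function.update τ i RowType.combinatorial) S' T E :=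
      hst.rowChild_left hτi ψ β
    have hAE : AE g A S' = AE g A S := by
      refine Set.Subset.antisymm (AE_rowChild_subset A S i ψ β) fun a ha => ?_
      exact mem_AE_rowChild ha (hgood (a i) ⟨a, ha, rfl⟩).1
    have hV' : ValidOnE g C A B S' T E := by
      intro X hX Y hY
      rw [hS', XSetE_rowChild] at hX
      have hsX : s X = β := by rw [hψ X]; exact hX.2
      have := hV X hX.1 Y hY
      rwa [hrun X Y hsX] at this
    have hD' : ∀ a ∈ AE g A S', ∀ b ∈ AE g B T, a ≠ b := by rw [hAE]; exact hD
    have hneA' : (AE g A S').Nonempty := by rw [hAE]; exact hneA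
    have hL' : Hard (AE g A S') (AE g B T) ℓ := by rw [hAE]; exact hL
    let r' : Fin m → Bool → ℕ := fun i' α => if i' = i then r i α - 1 else r i' α
    have hR' : ∀ i' α, Alive g A B S' T i' α → Hard (RA g S' i' α) (RA g T i' (!α)) (r' i' α) := by
      intro i' α hal
      have hal0 : Alive g A B S T i' α := hal.mono (by rw [hAE]) (fun _ h => h)
      by_cases h : i' = i
      · subst h
        have hr' : r' i' α = r i' α - 1 := by simp [r']
        rw [hr', hS', RA_rowChild_self]
        exact (hgood α hal0.1).2 hal0
      · have hr' : r' i' α = r i' α := by simp [r', h]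
        rw [hr', hS', RA_rowChild_of_ne _ _ _ _ h]
        exact hR i' α hal0
    have hK' : ∀ i' α, Alive g A B S' T i' α →
        K - 1 ≤ r' i' α + cst (AE g A S') i' + cst (AE g B T) i' := by
      intro i' α hal
      have hal0 : Alive g A B S T i' α := hal.mono (by rw [hAE]) (fun _ h => h)
      have hk := hK i' α hal0
      rw [hAE]
      by_cases h : i' = i
      · subst h
        have hr' : r' i' α = r i' α - 1 := by simp [r']
        rw [hr']; omega
      · have hr' : r' i' α = r i' α := by simp [r', h]
        rw [hr']; omega
    have := hIC A B S' T E k hst' hsat hload hV' hD' hneA' hneB ℓ (K - 1) r' hL' hR' hK'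
    simp only [KWTree.depth_alice]
    omega
  · -- CASE B
    have hA' : ∀ β, ∃ α, (∃ a ∈ AE g A S, a i = α) ∧ ¬ Good β α := by
      intro β
      by_contra hcon
      exact hA ⟨β, fun α hα => by by_contra hbad; exact hcon ⟨α, hα, hbad⟩⟩
    obtain ⟨v, hne, hH⟩ := hL.split_alice hneA i₀ (fun a => a i)
    obtain ⟨a₁, ha₁, ha₁i⟩ := hne
    have ha₁i : a₁ i = v := ha₁i
    obtain ⟨β, hβne, hβH⟩ := G v ⟨a₁, ha₁, ha₁i⟩
    obtain ⟨α₂, ⟨a₂, ha₂, ha₂i⟩, hbad⟩ := hA' β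
    have hα₂ : α₂ ≠ v := by rintro rfl; exact hbad ⟨hβne, hβH⟩
    have hcst0 : cst (AE g A S) i = 0 :=
      cst_eq_zero ha₁ ha₂ (by rw [ha₁i, ha₂i]; exact Ne.symm hα₂)
    obtain ⟨C, hIC, hCd, hrun⟩ := alice_childAt (s := s) hIP hIQ β
    set S' := rowChild S i ψ β with hS'
    have hst' : StateOK (Function.update τ i RowType.combinatorial) S' T E :=
      hst.rowChild_left hτi ψ β
    set A' : Set (Fin m → Bool) := A ∩ {a | a i = v} with hA'def
    have hAE : AE g A' S' = AE g A S ∩ {a | a i = v} := by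
      ext a
      constructor
      · intro ha
        have ha0 : a ∈ AE g A S' := ⟨ha.1.1, ha.2⟩
        exact ⟨AE_rowChild_subset A S i ψ β ha0, ha.1.2⟩
      · rintro ⟨ha, hai⟩
        have hai : a i = v := hai
        have h' := mem_AE_rowChild (ψ := ψ) (β := β) ha (by rw [hai]; exact hβne)
        exact ⟨⟨ha.1, hai⟩, h'.2⟩
    have hsub : AE g A' S' ⊆ AE g A S := by rw [hAE]; exact Set.inter_subset_left
    have hV' : ValidOnE g C A' B S' T E := by
      intro X hX Y hY
      have hX0 : X ∈ XSetE g A S' E := ⟨hX.1.1, hX.2⟩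
      rw [hS', XSetE_rowChild] at hX0
      have hsX : s X = β := by rw [hψ X]; exact hX0.2
      have := hV X hX0.1 Y hY
      rwa [hrun X Y hsX] at this
    have hD' : ∀ a ∈ AE g A' S', ∀ b ∈ AE g B T, a ≠ b := fun a ha b hb => hD a (hsub ha) b hb
    have hneA' : (AE g A' S').Nonempty := by rw [hAE]; exact ⟨a₁, ha₁, ha₁i⟩
    have hL' : Hard (AE g A' S') (AE g B T) (ℓ - 1) := by rw [hAE]; exact hH
    let r' : Fin m → Bool → ℕ := fun i' α => if i' = i then r i α - 1 else r i' α
    have hR' : ∀ i' α, Alive g A' B S' T i' α → Hard (RA g S' i' α) (RA g T i' (!α)) (r' i' α) := by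
      intro i' α hal
      have hal0 : Alive g A B S T i' α := hal.mono hsub (fun _ h => h)
      by_cases h : i' = i
      · subst h
        obtain ⟨⟨a, ha, hai⟩, -⟩ := hal
        rw [hAE] at ha
        have hαv : α = v := by rw [← hai]; exact ha.2
        subst hαv
        have hr' : r' i' α = r i' α - 1 := by simp [r']
        rw [hr', hS', RA_rowChild_self]
        exact hβH hal0
      · have hr' : r' i' α = r i' α := by simp [r', h]
        rw [hr', hS', RA_rowChild_of_ne _ _ _ _ h]
        exact hR i' α hal0
    have hK' : ∀ i' α, Alive g A' B S' T i' α →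
        K ≤ r' i' α + cst (AE g A' S') i' + cst (AE g B T) i' := by
      intro i' α hal
      have hal0 : Alive g A B S T i' α := hal.mono hsub (fun _ h => h)
      have hk := hK i' α hal0
      have hc := cst_mono hsub i'
      by_cases h : i' = i
      · subst h
        obtain ⟨⟨a, ha, hai⟩, -⟩ := hal
        rw [hAE] at ha
        have hαv : α = v := by rw [← hai]; exact ha.2
        subst hαv
        have hr' : r' i' α = r i' α - 1 := by simp [r']
        have hc1 : cst (AE g A' S') i' = 1 := cst_eq_one (v := α) (fun a' ha' => by
          rw [hAE] at ha'; exact ha'.2)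
        rw [hr', hc1]
        rw [hcst0] at hk
        omega
      · have hr' : r' i' α = r i' α := by simp [r', h]
        rw [hr']; omega
    have := hIC A' B S' T E k hst' hsat hload hV' hD' hneA' hneB (ℓ - 1) K r' hL' hR' hK'
    simp only [KWTree.depth_alice]
    omega

/-- BOB SINGLE-ROW TEST on a non-algebraic row `i` (mirror image of `row_stepAt_alice`). -/
theorem row_stepAt_bob (i₀ : Fin m) (j₀ : Fin n) {τ : Fin m → RowType}
    {s : (Fin m × Fin n → Bool) → Bool} {P Q : KWTree (Fin m × Fin n)} {i : Fin m}
    {ψ : (Fin n → Bool) → Bool} (hψ : ∀ Y, s Y = ψ (row Y i)) (hτi : τ i ≠ RowType.algebraic)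
    (hIP : InvAt g q (Function.update τ i RowType.combinatorial) P)
    (hIQ : InvAt g q (Function.update τ i RowType.combinatorial) Q) :
    InvAt g q τ (KWTree.bob s P Q) := by
  classical
  intro A B S T E k hst hsat hload hV hD hneA hneB ℓ K r hL hR hK
  let Good : Bool → Bool → Prop := fun β α =>
    (RA g T i (!α) ∩ {y | ψ y = β}).Nonempty ∧
      (Alive g A B S T i α → Hard (RA g S i α) (RA g T i (!α) ∩ {y | ψ y = β}) (r i α - 1))
  have G : ∀ α, (∃ b ∈ AE g B T, b i = !α) → ∃ β, Good β α := by
    rintro α ⟨b, hb, hbi⟩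
    obtain ⟨y, hy, hgy⟩ := hb.2 i
    have hyα : y ∈ RA g T i (!α) := ⟨hy, by rw [Set.mem_setOf_eq, hgy, hbi]⟩
    by_cases hal : Alive g A B S T i α
    · obtain ⟨β, hβne, hβH⟩ := (hR i α hal).split_bob ⟨y, hyα⟩ j₀ ψ
      exact ⟨β, hβne, fun _ => hβH⟩
    · exact ⟨ψ y, ⟨y, hyα, rfl⟩, fun h => (hal h).elim⟩
  by_cases hA : ∃ β, ∀ α, (∃ b ∈ AE g B T, b i = !α) → Good β α
  · -- CASE A
    obtain ⟨β, hgood⟩ := hA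
    obtain ⟨C, hIC, hCd, hrun⟩ := bob_childAt (s := s) hIP hIQ β
    set T' := rowChild T i ψ β with hT'
    have hst' : StateOK (Function.update τ i RowType.combinatorial) S T' E :=
      hst.rowChild_right hτi ψ β
    have hAE : AE g B T' = AE g B T := by
      refine Set.Subset.antisymm (AE_rowChild_subset B T i ψ β) fun b hb => ?_
      have h1 := (hgood (!(b i)) ⟨b, hb, by simp⟩).1
      simp only [Bool.not_not] at h1
      exact mem_AE_rowChild hb h1
    have hV' : ValidOnE g C A B S T' E := by
      intro X hX Y hY
      rw [hT', XSetE_rowChild] at hY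
      have hsY : s Y = β := by rw [hψ Y]; exact hY.2
      have := hV X hX Y hY.1
      rwa [hrun X Y hsY] at this
    have hD' : ∀ a ∈ AE g A S, ∀ b ∈ AE g B T', a ≠ b := by rw [hAE]; exact hD
    have hneB' : (AE g B T').Nonempty := by rw [hAE]; exact hneB
    have hL' : Hard (AE g A S) (AE g B T') ℓ := by rw [hAE]; exact hL
    let r' : Fin m → Bool → ℕ := fun i' α => if i' = i then r i α - 1 else r i' α
    have hR' : ∀ i' α, Alive g A B S T' i' α → Hard (RA g S i' α) (RA g T' i' (!α)) (r' i' α) := by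
      intro i' α hal
      have hal0 : Alive g A B S T i' α := hal.mono (fun _ h => h) (by rw [hAE])
      by_cases h : i' = i
      · subst h
        have hr' : r' i' α = r i' α - 1 := by simp [r']
        rw [hr', hT', RA_rowChild_self]
        exact (hgood α hal0.2).2 hal0
      · have hr' : r' i' α = r i' α := by simp [r', h]
        rw [hr', hT', RA_rowChild_of_ne _ _ _ _ h]
        exact hR i' α hal0
    have hK' : ∀ i' α, Alive g A B S T' i' α →
        K - 1 ≤ r' i' α + cst (AE g A S) i' + cst (AE g B T') i' := by
      intro i' α hal
      have hal0 : Alive g A B S T i' α := hal.mono (fun _ h => h) (by rw [hAE])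
      have hk := hK i' α hal0
      rw [hAE]
      by_cases h : i' = i
      · subst h
        have hr' : r' i' α = r i' α - 1 := by simp [r']
        rw [hr']; omega
      · have hr' : r' i' α = r i' α := by simp [r', h]
        rw [hr']; omega
    have := hIC A B S T' E k hst' hsat hload hV' hD' hneA hneB' ℓ (K - 1) r' hL' hR' hK'
    simp only [KWTree.depth_bob]
    omega
  · -- CASE B
    have hA' : ∀ β, ∃ α, (∃ b ∈ AE g B T, b i = !α) ∧ ¬ Good β α := by
      intro β
      by_contra hcon
      exact hA ⟨β, fun α hα => by by_contra hbad; exact hcon ⟨α, hα, hbad⟩⟩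
    obtain ⟨w, hne, hH⟩ := hL.split_bob hneB i₀ (fun b => b i)
    obtain ⟨b₁, hb₁, hb₁i⟩ := hne
    have hb₁i : b₁ i = w := hb₁i
    obtain ⟨β, hβne0, hβH0⟩ := G (!w) ⟨b₁, hb₁, by rw [hb₁i, Bool.not_not]⟩
    have hβne : (RA g T i w ∩ {y | ψ y = β}).Nonempty := by simpa only [Bool.not_not] using hβne0
    have hβH : Alive g A B S T i (!w) →
        Hard (RA g S i (!w)) (RA g T i w ∩ {y | ψ y = β}) (r i (!w) - 1) := by
      simpa only [Bool.not_not] using hβH0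
    obtain ⟨α₂, ⟨b₂, hb₂, hb₂i⟩, hbad⟩ := hA' β
    have hα₂ : α₂ ≠ !w := by rintro rfl; exact hbad ⟨hβne0, hβH0⟩
    have hcst0 : cst (AE g B T) i = 0 :=
      cst_eq_zero hb₁ hb₂ (by rw [hb₁i, hb₂i]; cases α₂ <;> cases w <;> simp_all)
    obtain ⟨C, hIC, hCd, hrun⟩ := bob_childAt (s := s) hIP hIQ β
    set T' := rowChild T i ψ β with hT'
    have hst' : StateOK (Function.update τ i RowType.combinatorial) S T' E :=
      hst.rowChild_right hτi ψ β
    set B' : Set (Fin m → Bool) := B ∩ {b | b i = w} with hB'def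
    have hAE : AE g B' T' = AE g B T ∩ {b | b i = w} := by
      ext b
      constructor
      · intro hb
        have hb0 : b ∈ AE g B T' := ⟨hb.1.1, hb.2⟩
        exact ⟨AE_rowChild_subset B T i ψ β hb0, hb.1.2⟩
      · rintro ⟨hb, hbi⟩
        have hbi : b i = w := hbi
        have h' := mem_AE_rowChild (ψ := ψ) (β := β) hb (by rw [hbi]; exact hβne)
        exact ⟨⟨hb.1, hbi⟩, h'.2⟩
    have hsub : AE g B' T' ⊆ AE g B T := by rw [hAE]; exact Set.inter_subset_left
    have hV' : ValidOnE g C A B' S T' E := by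
      intro X hX Y hY
      have hY0 : Y ∈ XSetE g B T' E := ⟨hY.1.1, hY.2⟩
      rw [hT', XSetE_rowChild] at hY0
      have hsY : s Y = β := by rw [hψ Y]; exact hY0.2
      have := hV X hX Y hY0.1
      rwa [hrun X Y hsY] at this
    have hD' : ∀ a ∈ AE g A S, ∀ b ∈ AE g B' T', a ≠ b := fun a ha b hb => hD a ha b (hsub hb)
    have hneB' : (AE g B' T').Nonempty := by rw [hAE]; exact ⟨b₁, hb₁, hb₁i⟩
    have hL' : Hard (AE g A S) (AE g B' T') (ℓ - 1) := by rw [hAE]; exact hH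
    let r' : Fin m → Bool → ℕ := fun i' α => if i' = i then r i α - 1 else r i' α
    have hR' : ∀ i' α, Alive g A B' S T' i' α → Hard (RA g S i' α) (RA g T' i' (!α)) (r' i' α) := by
      intro i' α hal
      have hal0 : Alive g A B S T i' α := hal.mono (fun _ h => h) hsub
      by_cases h : i' = i
      · subst h
        obtain ⟨-, ⟨b, hb, hbi⟩⟩ := hal
        rw [hAE] at hb
        have hαw : α = !w := by
          have : b i' = w := hb.2
          rw [this] at hbi
          rw [hbi, Bool.not_not]
        subst hαw
        have hr' : r' i' (!w) = r i' (!w) - 1 := by simp [r']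
        rw [hr', Bool.not_not, hT', RA_rowChild_self]
        exact hβH hal0
      · have hr' : r' i' α = r i' α := by simp [r', h]
        rw [hr', hT', RA_rowChild_of_ne _ _ _ _ h]
        exact hR i' α hal0
    have hK' : ∀ i' α, Alive g A B' S T' i' α →
        K ≤ r' i' α + cst (AE g A S) i' + cst (AE g B' T') i' := by
      intro i' α hal
      have hal0 : Alive g A B S T i' α := hal.mono (fun _ h => h) hsub
      have hk := hK i' α hal0
      have hc := cst_mono hsub i'
      by_cases h : i' = i
      · subst h
        obtain ⟨-, ⟨b, hb, hbi⟩⟩ := hal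
        rw [hAE] at hb
        have hαw : α = !w := by
          have : b i' = w := hb.2
          rw [this] at hbi
          rw [hbi, Bool.not_not]
        subst hαw
        have hr' : r' i' (!w) = r i' (!w) - 1 := by simp [r']
        have hc1 : cst (AE g B' T') i' = 1 := cst_eq_one (v := w) (fun b' hb' => by
          rw [hAE] at hb'; exact hb'.2)
        rw [hr', hc1]
        rw [hcst0] at hk
        omega
      · have hr' : r' i' α = r i' α := by simp [r', h]
        rw [hr']; omega
    have := hIC A B' S T' E k hst' hsat hload hV' hD' hneA hneB' (ℓ - 1) K r' hL' hR' hK'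
    simp only [KWTree.depth_bob]
    omega

/-- **The adversary theorem**: every disciplined subtree satisfies the glued invariant at its typing. -/
theorem invAt_of_disciplined (hLU : PerRowLU g m q) (i₀ : Fin m) (j₀ : Fin n) :
    ∀ (P : KWTree (Fin m × Fin n)) (τ : Fin m → RowType), LRADisciplinedOn g τ P → InvAt g q τ P
  | .leaf p, τ, _ => inv_leafAt hLU p τ
  | .alice s P Q, τ, h => by
    obtain ⟨τ', hN, hP, hQ⟩ := h
    have ihP := invAt_of_disciplined hLU i₀ j₀ P τ' hP
    have ihQ := invAt_of_disciplined hLU i₀ j₀ Q τ' hQ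
    rcases hN with ⟨⟨φ, hφ⟩, hτ'⟩ | ⟨S₀, c, hs, hτ, hτ'⟩ | ⟨i, ψ, hs, hτi, hτ'⟩
    · subst hτ'; exact label_stepAt_alice i₀ hφ ihP ihQ
    · subst hτ'; exact affine_stepAt_alice hLU hs hτ ihP ihQ
    · subst hτ'; exact row_stepAt_alice i₀ j₀ hs hτi ihP ihQ
  | .bob s P Q, τ, h => by
    obtain ⟨τ', hN, hP, hQ⟩ := h
    have ihP := invAt_of_disciplined hLU i₀ j₀ P τ' hP
    have ihQ := invAt_of_disciplined hLU i₀ j₀ Q τ' hQ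
    rcases hN with ⟨⟨φ, hφ⟩, hτ'⟩ | ⟨S₀, c, hs, hτ, hτ'⟩ | ⟨i, ψ, hs, hτi, hτ'⟩
    · subst hτ'; exact label_stepAt_bob i₀ hφ ihP ihQ
    · subst hτ'; exact affine_stepAt_bob hLU hs hτ ihP ihQ
    · subst hτ'; exact row_stepAt_bob i₀ j₀ hs hτi ihP ihQ

/-- **The glued adversary bound, per-row form**: with per-row budget `q` every disciplined protocol for
the strong game has `ℓ + min dg q ≤ depth + 2`. -/
theorem lrad_rect_bound {f : (Fin m → Bool) → Bool} {dg ℓ : ℕ}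
    (hf : ∃ a b, f a = true ∧ f b = false) (hdg : ∀ R : KWTree (Fin n), R.Solves g → dg ≤ R.depth)
    (hLU : PerRowLU g m q) (hH : Hard (f ⁻¹' {true}) (f ⁻¹' {false}) ℓ)
    {P : KWTree (Fin m × Fin n)} (hP : LRADisciplined g P) (hsol : P.SolvesStrong f g) :
    ℓ + min dg q ≤ P.depth + 2 := by
  classical
  -- `m ≥ 1` (f non-constant) and a coordinate `i₀`
  obtain ⟨a₁, b₁, hfa₁, hfb₁⟩ := hf
  have hm : 0 < m := by
    rcases Nat.eq_zero_or_pos m with h0 | h0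
    · exfalso
      subst h0
      have : a₁ = b₁ := funext fun i => i.elim0
      rw [this, hfb₁] at hfa₁
      exact Bool.false_ne_true hfa₁
    · exact h0
  let i₀ : Fin m := ⟨0, hm⟩
  -- `g` takes both values (per-row universality of the empty system) and a coordinate `j₀`
  have hsat0 : ∃ X, Sat ([] : AffSys m n) X := ⟨fun _ => false, fun e he => by simp at he⟩
  have hload0 : ∀ i, rowLoad ([] : AffSys m n) i ≤ q := fun i => by rw [rowLoad_nil]; exact Nat.zero_le _
  have hgα : ∀ α : Bool, ∃ x, g x = α := by
    intro α
    obtain ⟨X, -, hX⟩ := hLU [] hload0 hsat0 (fun _ => α)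
    exact ⟨row X i₀, by have := congrFun hX i₀; simpa using this⟩
  obtain ⟨x₁, hx₁⟩ := hgα true
  obtain ⟨y₁, hy₁⟩ := hgα false
  have hne_xy : x₁ ≠ y₁ := fun h => by rw [h, hy₁] at hx₁; exact Bool.false_ne_true hx₁
  obtain ⟨j₀, -⟩ : ∃ j : Fin n, x₁ j ≠ y₁ j := by
    by_contra h
    push Not at h
    exact hne_xy (funext h)
  -- the root state
  let U : Fin m → Set (Fin n → Bool) := fun _ => Set.univ
  set A : Set (Fin m → Bool) := f ⁻¹' {true} with hA
  set B : Set (Fin m → Bool) := f ⁻¹' {false} with hB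
  have hAE_A : AE g A U = A := AE_root hgα A
  have hAE_B : AE g B U = B := AE_root hgα B
  have hst : StateOK (fun _ : Fin m => RowType.fresh) U U ([] : AffSys m n) := fun i =>
    ⟨fun _ => rowLoad_nil i, fun _ => ⟨rfl, rfl⟩⟩
  have hload : ∀ i, rowLoad ([] : AffSys m n) i + q ≤ q := fun i => by rw [rowLoad_nil, Nat.zero_add]
  have hV : ValidOnE g P A B U U [] := by
    intro X hX Y hY
    have hX1 : f (rowLabels g X) = true := by simpa [hA] using hX.1
    have hY1 : f (rowLabels g Y) = false := by simpa [hB] using hY.1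
    exact hsol X Y (by rw [blockComp_apply]; exact hX1) (by rw [blockComp_apply]; exact hY1)
  have hD : ∀ a ∈ AE g A U, ∀ b ∈ AE g B U, a ≠ b := by
    rw [hAE_A, hAE_B]
    rintro a ha b hb rfl
    have ha' : f a = true := by simpa [hA] using ha
    have hb' : f a = false := by simpa [hB] using hb
    rw [ha'] at hb'
    exact Bool.noConfusion hb'
  have hneA : (AE g A U).Nonempty := by rw [hAE_A]; exact ⟨a₁, by simpa [hA] using hfa₁⟩
  have hneB : (AE g B U).Nonempty := by rw [hAE_B]; exact ⟨b₁, by simpa [hB] using hfb₁⟩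
  have hL : Hard (AE g A U) (AE g B U) ℓ := by rw [hAE_A, hAE_B]; exact hH
  have hR : ∀ i α, Alive g A B U U i α → Hard (RA g U i α) (RA g U i (!α)) dg := by
    intro i α _ R hRsol
    cases α
    · have hsol' : R.swap.Solves g := by
        intro a b ha hb
        rw [KWTree.run_swap]
        have := hRsol b ⟨Set.mem_univ _, hb⟩ a ⟨Set.mem_univ _, by simpa using ha⟩
        exact fun h => this h.symm
      simpa using hdg R.swap hsol'
    · exact hdg R fun a b ha hb => hRsol a ⟨Set.mem_univ _, ha⟩ b ⟨Set.mem_univ _, by simpa using hb⟩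
  have hK : ∀ i α, Alive g A B U U i α → dg ≤ dg + cst (AE g A U) i + cst (AE g B U) i :=
    fun _ _ _ => by omega
  exact invAt_of_disciplined hLU i₀ j₀ P _ hP A B U U [] q hst hsat0 hload hV hD hneA hneB ℓ dg
    (fun _ _ => dg) hL hR hK

/-- **KRW form of the glued bound**: from any disciplined protocol `P` for the strong composition game
`KW_f ⊛ KW_g` (`f` non-constant, `g` of KW-depth `≥ dg` and label-universal with per-row budget `q`) one
extracts a `KW_f` protocol `Q` with `Q.depth + min dg q ≤ P.depth + 2` — i.e.
`D_LRAD(KW_f ⊛ KW_g) ≥ D(KW_f) + min(D(KW_g), q) − 2`, no `log` slack. -/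
theorem exists_solves_of_lraDisciplined {f : (Fin m → Bool) → Bool} {dg : ℕ}
    (hf : ∃ a b, f a ≠ f b) (hdg : ∀ R : KWTree (Fin n), R.Solves g → dg ≤ R.depth)
    (hLU : PerRowLU g m q) {P : KWTree (Fin m × Fin n)} (hP : LRADisciplined g P)
    (hsol : P.SolvesStrong f g) :
    ∃ Q : KWTree (Fin m), Q.Solves f ∧ Q.depth + min dg q ≤ P.depth + 2 := by
  classical
  have hne : ∃ a b, f a = true ∧ f b = false := by
    obtain ⟨a, b, hab⟩ := hf
    cases ha : f a <;> cases hb : f b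
    · rw [ha, hb] at hab; exact absurd rfl hab
    · exact ⟨b, a, hb, ha⟩
    · exact ⟨a, b, ha, hb⟩
    · rw [ha, hb] at hab; exact absurd rfl hab
  by_contra hcon
  push Not at hcon
  set ℓ := P.depth + 3 - min dg q with hℓ
  have hH : Hard (f ⁻¹' {true}) (f ⁻¹' {false}) ℓ := by
    intro Q hQ
    have hs : Q.Solves f := fun a b ha hb => hQ a (by simpa using ha) b (by simpa using hb)
    have := hcon Q hs
    omega
  have hmain := lrad_rect_bound hne hdg hLU hH hP hsol
  omega

end Steps

end Gluing

/-! ## Registered stub and composition -/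

/-- **STUB — PROVED** (the only one): the gluing adversary on the disciplined class — memo
`LensBarrierP4g19.md` §5.3 (state = label rectangle × per-row row-sets on combinatorial rows × a common
affine system with per-row loads on algebraic rows; potential `ℓ + min(K, k)`; private collapse at
`k = 0`); `lrad_rect_bound` gives the sharper per-row form `ℓ + min dg q ≤ depth + 2`. -/
theorem stub_lradQuantitative : LRADQuantitative := by
  intro m n q dg ℓ f g hf hdg hLU _hq hH P hP hsol
  have h := lrad_rect_bound hf hdg hLU hH hP hsol
  omega

/-- **Composition (implication form)**: the rung from the stub statement — no `sorry` (assembly + S0–S3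
proved above). -/
theorem StrongCompositionLRAD_of_sigs : LRADQuantitative → StrongCompositionLRAD :=
  strongCompositionLRAD_of_quantitative

/-- **Composition (registrar shape)**: concludes the registered target BY NAME from the registered stub. -/
theorem StrongCompositionLRAD_of : StrongCompositionLRAD :=
  StrongCompositionLRAD_of_sigs stub_lradQuantitative

/-! ### Non-vacuity of the rung: the obvious protocol is disciplined
The class LRAD contains INDEPENDENT PLAY (`KWTree.compose`: run a `KW_f` protocol on the label columns, then a
`KW_g` protocol on the row found), so `StrongCompositionLRAD` is matched from above by a disciplined protocol of
depth `D(KW_f) + D(KW_g) + 1` (`KWTree.depth_compose`, `KWTree.solvesStrong_compose`): the rung says no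
disciplined protocol beats independent play by more than `O(log mn)` rounds. -/

section NonVacuity

variable {m n : ℕ}

/-- Playing a row protocol on row `i` (`KWTree.onRow`) is disciplined from every typing in which row `i` is
not algebraic (all its nodes are single-row tests on row `i`). -/
theorem lraDisciplinedOn_onRow (g : (Fin n → Bool) → Bool) (i : Fin m) :
    ∀ (R : KWTree (Fin n)) (τ : Fin m → RowType), τ i ≠ RowType.algebraic →
      LRADisciplinedOn g τ (KWTree.onRow (m := m) i R)
  | .leaf _, _, _ => trivial
  | .alice s P Q, τ, hτ => by
    simp only [KWTree.onRow, KWTree.comap]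
    refine ⟨Function.update τ i .combinatorial, Or.inr (Or.inr ⟨i, s, fun X => rfl, hτ, rfl⟩), ?_, ?_⟩
    · exact lraDisciplinedOn_onRow g i P _
        (by rw [Function.update_self]; exact fun h => RowType.noConfusion h)
    · exact lraDisciplinedOn_onRow g i Q _
        (by rw [Function.update_self]; exact fun h => RowType.noConfusion h)
  | .bob s P Q, τ, hτ => by
    simp only [KWTree.onRow, KWTree.comap]
    refine ⟨Function.update τ i .combinatorial, Or.inr (Or.inr ⟨i, s, fun X => rfl, hτ, rfl⟩), ?_, ?_⟩
    · exact lraDisciplinedOn_onRow g i P _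
        (by rw [Function.update_self]; exact fun h => RowType.noConfusion h)
    · exact lraDisciplinedOn_onRow g i Q _
        (by rw [Function.update_self]; exact fun h => RowType.noConfusion h)

/-- The obvious protocol `KWTree.compose g R Q` is disciplined from every typing without algebraic rows: its
nodes are label tests (those of `Q` on the label columns) and single-row tests (the announcement `g(X_i)` and
the nodes of `R` on row `i`). -/
theorem lraDisciplinedOn_compose (g : (Fin n → Bool) → Bool) (R : KWTree (Fin n)) :
    ∀ (Q : KWTree (Fin m)) (τ : Fin m → RowType), (∀ i, τ i ≠ RowType.algebraic) →
      LRADisciplinedOn g τ (KWTree.compose g R Q)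
  | .leaf i, τ, hτ => by
    simp only [KWTree.compose]
    refine ⟨Function.update τ i .combinatorial, Or.inr (Or.inr ⟨i, g, fun X => rfl, hτ i, rfl⟩), ?_, ?_⟩
    · exact lraDisciplinedOn_onRow g i R.swap _
        (by rw [Function.update_self]; exact fun h => RowType.noConfusion h)
    · exact lraDisciplinedOn_onRow g i R _
        (by rw [Function.update_self]; exact fun h => RowType.noConfusion h)
  | .alice s P Q, τ, hτ => by
    simp only [KWTree.compose]
    exact ⟨τ, Or.inl ⟨⟨s, fun X => rfl⟩, rfl⟩, lraDisciplinedOn_compose g R P τ hτ,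
      lraDisciplinedOn_compose g R Q τ hτ⟩
  | .bob s P Q, τ, hτ => by
    simp only [KWTree.compose]
    exact ⟨τ, Or.inl ⟨⟨s, fun X => rfl⟩, rfl⟩, lraDisciplinedOn_compose g R P τ hτ,
      lraDisciplinedOn_compose g R Q τ hτ⟩

/-- **Independent play is disciplined**: `KWTree.compose g R Q ∈ LRAD`. -/
theorem lraDisciplined_compose (g : (Fin n → Bool) → Bool) (R : KWTree (Fin n)) (Q : KWTree (Fin m)) :
    LRADisciplined g (KWTree.compose g R Q) :=
  lraDisciplinedOn_compose g R Q _ fun _ h => RowType.noConfusion h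

/-- **The rung is matched from above inside the class**: from any `KW_f` protocol `Q` and `KW_g` protocol `R`
a DISCIPLINED protocol for the strong game of depth `Q.depth + R.depth + 1` (so `StrongCompositionLRAD` says:
no disciplined protocol beats independent play by more than `O(log mn)` rounds). -/
theorem exists_lraDisciplined_solvesStrong {f : (Fin m → Bool) → Bool} {g : (Fin n → Bool) → Bool}
    {Q : KWTree (Fin m)} {R : KWTree (Fin n)} (hQ : Q.Solves f) (hR : R.Solves g) :
    ∃ P : KWTree (Fin m × Fin n), LRADisciplined g P ∧ P.SolvesStrong f g ∧
      P.depth = Q.depth + R.depth + 1 :=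
  ⟨KWTree.compose g R Q, lraDisciplined_compose g R Q, KWTree.solvesStrong_compose hQ hR,
    KWTree.depth_compose g R Q⟩

end NonVacuity

end Summit.PneNP.PneNP.Cruxes.StrongComposition.LradGluing
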